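import Literature.Computability.Complexity.HardcoreInapproximabilityProofs
import Literature.Computability.Complexity.HardcoreInapproximabilityPhi
import Literature.Computability.Complexity.HardcoreInapproximabilitySums
import Literature.Probability.LatticeModels.BinomialEntropy
import HarnessLib

/-!
# Ingredients of Sly's gadget theorem (Theorem 2.1), proved — II: first-moment asymptotics

Continuation of `HardcoreInapproximabilityProofs.lean` (same namespace; that file holds the constants
`q^{±}`, `p^{±}`, Kelly's uniqueness, the maximisation of Sly's first-moment exponent `Φ₁` and its
power-law gap, the exact first moments `mww_firstMoment`, `sly_firstMoment` and Lemmas 3.1–3.2), toward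
the first-moment half of Sly's Lemma 3.3
(`sup_η |E Z^{±}_{G̃}(η)/E Z^{±}_{G̃} - Q_U^{±}(η)| = o(1)`, `E Z⁺_{G̃} = (1+o(1)) E Z⁻_{G̃}`), all about
explicit finite sums:

* `sly_lemma33_phases` — **Lemma 3.3 as displayed, (e:gtEZa) and (e:gtEZb)**: with
  `E Z^{±}_{G̃} = Σ_{η⁺,η⁻ ≤ m'} C(m',η⁺) C(m',η⁻) E Z^{±}_{G̃}(η⁺,η⁻)` and Sly's `Q_U^{±}(η)` (from
  `q⁺ = p⁺/(1-p⁻)`, `q⁻ = p⁻/(1-p⁺)`): `|E Z⁺_{G̃} - E Z⁻_{G̃}| ≤ ε E Z⁻_{G̃}` and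
  `|E Z^{±}_{G̃}(η) - Q_U^{±}(η) E Z^{±}_{G̃}| ≤ ε Q_U^{±}(η) E Z^{±}_{G̃}` for all large `n`, `m' ≤ n^γ`, all `η`
  (binomial resummation `sum_choose_mul_pow_eq`, `pow_div_pow_eq_portLaw`);
* `sly_lemma33` — **Sly's Lemma 3.3 (first-moment form)**: for `λ > λ_c(𝕋_d)` and the critical
  point `(p⁺,p⁻)` there is `γ > 0` such that for every `ε > 0`, all large `n`, all `m' ≤ n^γ` there is
  `A > 0` with `|E Z⁺_{G̃}(η) - A (p⁺/u*)^{η⁺}(p⁻/u*)^{η⁻}| ≤ ε A (p⁺/u*)^{η⁺}(p⁻/u*)^{η⁻}` and the mirror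
  statement for `E Z⁻_{G̃}(η)`, for all `η^{±} ≤ m'` (the sums `slyZplus`, `slyZminus` of
  `HardcoreInapproximabilitySums`); the multiplicative, uniform-in-`η` form of Sly's (e:gtEZ4) from which
  (e:gtEZa) and (e:gtEZb) follow by summing over `η` (`sly_offWindow_pointwise`,
  `sly_window_eventually`, `abs_log_slyF_div_mwwF_sub_le`, `sly_plus_window_sums`,
  `slyZminus_eq_slyZplus_sub`);
* `abs_log_mwwFirstMoment_sub_le` — **`E Z^{α,β}_{MWW} ≈ exp(nΦ₁(α,β))` up to a polynomial
  factor** (Mossel–Weitz–Wormald 2009, Prop. 3.1, as used in Sly's proof of Lemma 3.3), explicitly: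
  `|log(λ^{a+b} C(n,a) C(n,b) [C(n-b,a)/C(n,a)]^d) - n Φ₁(a/n, b/n)| ≤ (d+2)((log n)/2 + 1)` for all
  `a + b ≤ n`, from the two-sided entropy bounds `log_choose_le_entropy`, `entropy_sub_le_log_choose`
  (`Literature.Probability.LatticeModels.BinomialEntropy`: Stirling with explicit constants) and the
  `x log x` form `natMul_slyPhi1_div` of `n Φ₁(a/n, b/n)`;
* `slyFirstMoment_le_mul_mww` — `E Z^{a,b}(η) ≤ λ^{η⁺+η⁻} (n+m')^{(d-1)m'} E Z^{a,b}_{MWW}` for all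
  `a + b ≤ n`: the crude bound used off the dominant window (`choose_div_choose_succ_le`,
  `choose_div_choose_add_le`, `choose_div_choose_anti`);
* `slyFirstMoment_swap` — `E Z^{a,b}(η⁺,η⁻) = E Z^{b,a}(η⁻,η⁺)` (swap the two halves of `G̃`), the
  reduction of the minus phase to the plus phase;
* `slyCritical_portWeight` — at the critical point the bases of the main term of Lemma 3.1 are
  `λ(u/(1-p^{∓}))^{d-1} = p^{±}/u = q^{±}/(1-q^{±})` (`u = 1-p⁺-p⁻`; Sly's eq. (e:pqRelation2), (e:gtEZ4));
* `slyPhi1_offWindow` — **the dominant windows** (Sly's (e:gtEZ2)): off the `n^{-1/(2ℓ)}`-windows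
  around `(p^{±}, p^{∓})`, `n Φ₁(a/n,b/n) + K n^{γ'} log n + 2 log(n+1) ≤ n Φ₁(⌊p⁺n⌋/n, ⌊p⁻n⌋/n) + log ε`
  for all large `n` (any `K`, `γ' < 1/2`, `ε > 0`): the power-law gap, the uniform gap, the `O(1/n)`
  loss at the anchor, and `-C√n + K n^{γ'} log n + 2 log n → -∞` (`tendsto_neg_sqrt_add_atBot`);
* `contDiffAt_slyPhi1`, `slyPhi1_lipschitz_near`, `abs_log_sub_log_le_near` — local Lipschitz bounds for
  `Φ₁` and for the logarithms in the main term of Lemma 3.1 near an interior point (uniformity over the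
  dominant window, Sly's (e:gtEZ3)).

## What is NOT here

Everything probabilistic in Theorem 2.1 (second moment, small
subgraph conditioning, reconstruction on the appended trees).

## References

* A. Sly, *Computational transition at the uniqueness threshold*, FOCS 2010, arXiv:1005.5584, §3
  (Lemma 3.1, Lemma 3.3 and their proofs) [Sly2010].
* E. Mossel, D. Weitz, N. Wormald, *On the hardness of sampling independent sets beyond the tree
  threshold*, Probab. Theory Related Fields 143 (2009), Prop. 3.1 (quoted from Sly §3).
-/

namespace Literature.Computability.Complexity

open Filter Topology Literature.Probability.LatticeModels

/-! ### `E Z^{α,β}_{MWW} ≈ exp(n Φ₁(α,β))` up to a polynomial factor (MWW09 Prop. 3.1)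

Two-sided entropy bounds for binomial coefficients with explicit constants,
`N log N - k log k - (N-k) log(N-k) - (log N)/2 - 1 ≤ log C(N,k) ≤ N log N - k log k - (N-k) log(N-k)`
(from `Literature.Probability.LatticeModels.BinomialEntropy`), the `x log x` form of `n Φ₁(a/n, b/n)`,
and the conclusion `|log E Z^{a,b}_{MWW} - n Φ₁(a/n,b/n)| ≤ (d+2)((log n)/2 + 1)` for all `a + b ≤ n`. -/

section FirstMomentEntropy

/-- **Entropy upper bound for binomial coefficients**, in `t log t` form:
`log C(N,k) ≤ N log N - k log k - (N-k) log(N-k)` (`= N H(k/N)`, the binary entropy in nats) for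
all `0 ≤ k ≤ N` (one term of the binomial expansion of `1 = (k/N + (N-k)/N)^N`;
`choose_le_exp_spinRate`). [folklore] -/
theorem log_choose_le_entropy (N k : ℕ) (hk : k ≤ N) :
    Real.log (N.choose k) ≤
      N * Real.log N - k * Real.log k - ((N : ℝ) - k) * Real.log ((N : ℝ) - k) := by
  rcases Nat.eq_zero_or_pos k with rfl | hk0
  · simp
  rcases eq_or_lt_of_le hk with rfl | hlt
  · simp
  have h := choose_le_exp_spinRate hk
  rw [← exp_entropy_eq hk0 hlt] at h
  have hpos : (0 : ℝ) < N.choose k := by exact_mod_cast Nat.choose_pos hk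
  calc Real.log (N.choose k)
      ≤ Real.log (Real.exp (N * Real.log N - k * Real.log k -
          ((N : ℝ) - k) * Real.log ((N : ℝ) - k))) := Real.log_le_log hpos h
    _ = _ := Real.log_exp _

/-- **Entropy lower bound for binomial coefficients** (Stirling with explicit constants):
`log C(N,k) ≥ N log N - k log k - (N-k) log(N-k) - (log N)/2 - 1` for all `0 ≤ k ≤ N`, `N ≥ 1`.
For `1 ≤ k ≤ N-1` this is `choose_eq_stirlingRatio` with `s(N)/(s(k)s(N-k)) ≥ 2√π/e²` and
`√(N/(2k(N-k))) ≥ √(2/N)`; at `k ∈ {0, N}` both entropies vanish. [folklore] -/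
theorem entropy_sub_le_log_choose (N k : ℕ) (hN : 1 ≤ N) (hk : k ≤ N) :
    N * Real.log N - k * Real.log k - ((N : ℝ) - k) * Real.log ((N : ℝ) - k) -
        Real.log N / 2 - 1 ≤ Real.log (N.choose k) := by
  have hN0 : (0 : ℝ) < N := by exact_mod_cast hN
  have hlogN : 0 ≤ Real.log N := Real.log_nonneg (by exact_mod_cast hN)
  rcases Nat.eq_zero_or_pos k with rfl | hk0
  · simp; linarith
  rcases eq_or_lt_of_le hk with rfl | hlt
  · simp; linarith
  have hk1 : 1 ≤ k := hk0
  have hkN : k + 1 ≤ N := hlt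
  rw [choose_eq_stirlingRatio hk1 hkN, ← exp_entropy_eq hk1 hkN]
  set E : ℝ := N * Real.log N - k * Real.log k - ((N : ℝ) - k) * Real.log ((N : ℝ) - k) with hE
  have hkR : (0 : ℝ) < k := by exact_mod_cast hk0
  have hNk : (0 : ℝ) < (N : ℝ) - k := by
    have : (k : ℝ) < N := by exact_mod_cast hlt
    linarith
  -- the Stirling ratio is at least `2√π/e²`
  have hr_pos : 0 < stirlingRatio N k := stirlingRatio_pos hk1 hkN
  have hr : Real.sqrt Real.pi / ((Real.exp 1 / Real.sqrt 2) * (Real.exp 1 / Real.sqrt 2)) ≤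
      stirlingRatio N k := by
    unfold stirlingRatio
    have h1 := sqrt_pi_le_stirlingSeq' (n := N) (by omega)
    have h2 := stirlingSeq_le_exp_one_div (n := k) (by omega)
    have h3 := stirlingSeq_le_exp_one_div (n := N - k) (by omega)
    have hp2 := stirlingSeq_pos (n := k) (by omega)
    have hp3 := stirlingSeq_pos (n := N - k) (by omega)
    have hsπ : 0 < Real.sqrt Real.pi := Real.sqrt_pos.2 Real.pi_pos
    calc Real.sqrt Real.pi / ((Real.exp 1 / Real.sqrt 2) * (Real.exp 1 / Real.sqrt 2))
        ≤ Real.sqrt Real.pi / (Stirling.stirlingSeq k * Stirling.stirlingSeq (N - k)) := by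
          apply div_le_div_of_nonneg_left hsπ.le (mul_pos hp2 hp3)
          exact mul_le_mul h2 h3 hp3.le (by positivity)
      _ ≤ Stirling.stirlingSeq N / (Stirling.stirlingSeq k * Stirling.stirlingSeq (N - k)) :=
          div_le_div_of_nonneg_right h1 (mul_pos hp2 hp3).le
  have hr_val : Real.sqrt Real.pi / ((Real.exp 1 / Real.sqrt 2) * (Real.exp 1 / Real.sqrt 2)) =
      2 * Real.sqrt Real.pi / Real.exp 2 := by
    have h2 : Real.sqrt 2 ^ 2 = 2 := Real.sq_sqrt zero_le_two
    rw [show Real.exp 2 = Real.exp 1 * Real.exp 1 by rw [← Real.exp_add]; norm_num]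
    field_simp
    rw [h2]
  rw [hr_val] at hr
  have hlog_r : Real.log Real.pi / 2 + Real.log 2 - 2 ≤ Real.log (stirlingRatio N k) := by
    have hpos : 0 < 2 * Real.sqrt Real.pi / Real.exp 2 := by positivity
    have := Real.log_le_log hpos hr
    rw [Real.log_div (by positivity) (Real.exp_pos 2).ne', Real.log_mul two_ne_zero (by positivity),
      Real.log_sqrt Real.pi_pos.le, Real.log_exp] at this
    linarith
  -- the square-root factor is at least `√(2/N)`
  have hs : Real.sqrt (2 / N) ≤ Real.sqrt (N / (2 * k * ((N : ℝ) - k))) := by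
    apply Real.sqrt_le_sqrt
    rw [div_le_div_iff₀ hN0 (by positivity)]
    nlinarith [sq_nonneg ((N : ℝ) - 2 * k)]
  have hlog_s : (Real.log 2 - Real.log N) / 2 ≤ Real.log (Real.sqrt (N / (2 * k * ((N : ℝ) - k)))) := by
    have hpos : 0 < Real.sqrt (2 / N) := Real.sqrt_pos.2 (by positivity)
    have := Real.log_le_log hpos hs
    rw [Real.log_sqrt (by positivity), Real.log_div two_ne_zero hN0.ne'] at this
    linarith
  -- numerical constants: `log 2 > 2/3`, `log π ≥ 0`
  have hlog2 : (2 : ℝ) / 3 < Real.log 2 := by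
    have := Real.log_two_gt_d9
    norm_num at this ⊢
    linarith
  have hlogπ : 0 ≤ Real.log Real.pi := Real.log_nonneg (by linarith [Real.pi_gt_three])
  have hspos : 0 < Real.sqrt (N / (2 * k * ((N : ℝ) - k))) := Real.sqrt_pos.2 (by positivity)
  rw [Real.log_mul (mul_pos hr_pos hspos).ne' (Real.exp_pos _).ne', Real.log_mul hr_pos.ne' hspos.ne',
    Real.log_exp]
  linarith

/-- `(x log x)`-form of the section `n Φ₁(a/n, b/n)`: for `n ≥ 1`,
`n Φ₁(a/n, b/n) = (a+b) log λ - a log a - b log b - d (n-a-b) log(n-a-b)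
  + (d-1)((n-a) log(n-a) + (n-b) log(n-b)) + (2-d) n log n`. [folklore] -/
theorem natMul_slyPhi1_div (d : ℕ) (lam : ℝ) {n : ℕ} (hn : 1 ≤ n) (a b : ℝ) :
    (n : ℝ) * slyPhi1 d lam (a / n) (b / n) =
      (a + b) * Real.log lam - a * Real.log a - b * Real.log b -
        d * ((n : ℝ) - a - b) * Real.log ((n : ℝ) - a - b) +
        (d - 1) * (((n : ℝ) - a) * Real.log ((n : ℝ) - a) + ((n : ℝ) - b) * Real.log ((n : ℝ) - b)) +
        (2 - d) * (n * Real.log n) := by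
  have hn0 : (n : ℝ) ≠ 0 := by exact_mod_cast (show n ≠ 0 by omega)
  -- `x log (x/n) = x log x - x log n` for every real `x` (both sides vanish at `x = 0`)
  have key : ∀ x : ℝ, x * Real.log (x / n) = x * Real.log x - x * Real.log n := by
    intro x
    rcases eq_or_ne x 0 with rfl | hx
    · simp
    · rw [Real.log_div hx hn0]; ring
  have e1 : 1 - a / n - b / n = ((n : ℝ) - a - b) / n := by field_simp
  have e2 : 1 - a / n = ((n : ℝ) - a) / n := by field_simp
  have e3 : 1 - b / n = ((n : ℝ) - b) / n := by field_simp
  rw [slyPhi1_def, e1, e2, e3]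
  have k1 := key a
  have k2 := key b
  have k3 := key ((n : ℝ) - a - b)
  have k4 := key ((n : ℝ) - a)
  have k5 := key ((n : ℝ) - b)
  -- multiply through by `n` and use the `key` identities
  have : (n : ℝ) * ((a / n + b / n) * Real.log lam - a / n * Real.log (a / n) - b / n * Real.log (b / n) -
      d * (((n : ℝ) - a - b) / n) * Real.log (((n : ℝ) - a - b) / n) +
      (d - 1) * (((n : ℝ) - a) / n * Real.log (((n : ℝ) - a) / n) + ((n : ℝ) - b) / n * Real.log (((n : ℝ) - b) / n))) =
      (a + b) * Real.log lam - a * Real.log (a / n) - b * Real.log (b / n) -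
      d * (((n : ℝ) - a - b) * Real.log (((n : ℝ) - a - b) / n)) +
      (d - 1) * (((n : ℝ) - a) * Real.log (((n : ℝ) - a) / n) + ((n : ℝ) - b) * Real.log (((n : ℝ) - b) / n)) := by
    field_simp
  rw [this, k1, k2, k3, k4, k5]
  ring

/-- **`E Z^{α,β}_{MWW} ≈ exp(n Φ₁(α,β))` up to a polynomial factor** (Mossel–Weitz–Wormald 2009,
Prop. 3.1, as used in Sly's proof of Lemma 3.3: "`E Z^{α,β}_{MWW} ≈ exp(Φ₁(α,β) n)` where the
approximation holds up to a polynomial factor in `n`"), with explicit constants: for `n ≥ 1`, `λ > 0`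
and integers `a, b ≥ 0` with `a + b ≤ n`,
`|log(λ^{a+b} C(n,a) C(n,b) [C(n-b,a)/C(n,a)]^d) - n Φ₁(a/n, b/n)| ≤ (d+2)((log n)/2 + 1)`
(the first moment itself is `mww_firstMoment`). Proof: the logarithm of the first moment minus
`n Φ₁` is a signed sum of `d + 2` binomial entropy defects
`log C(N,k) - [N log N - k log k - (N-k) log(N-k)] ∈ [-(log N)/2 - 1, 0]`
(`log_choose_le_entropy`, `entropy_sub_le_log_choose`).
[cite: Sly2010, proof of Lemma 3.3 (the display `E Z^{α,β}_{MWW} ≈ exp(Φ₁(α,β) n)`, after Mossel–Weitz–Wormald 2009 Prop. 3.1)] -/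
theorem abs_log_mwwFirstMoment_sub_le {n a b : ℕ} (d : ℕ) {lam : ℝ} (hlam : 0 < lam) (hn : 1 ≤ n)
    (hab : a + b ≤ n) :
    |Real.log (lam ^ (a + b) * (n.choose a) * (n.choose b) * (((n - b).choose a : ℝ) / (n.choose a)) ^ d) -
        n * slyPhi1 d lam (a / n) (b / n)| ≤ ((d : ℝ) + 2) * (Real.log n / 2 + 1) := by
  have ha : a ≤ n := by omega
  have hb : b ≤ n := by omega
  have hab' : a ≤ n - b := by omega
  have hn0 : (0 : ℝ) < n := by exact_mod_cast hn
  have hlogN : 0 ≤ Real.log n := Real.log_nonneg (by exact_mod_cast hn)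
  have hCa : (0 : ℝ) < n.choose a := by exact_mod_cast Nat.choose_pos ha
  have hCb : (0 : ℝ) < n.choose b := by exact_mod_cast Nat.choose_pos hb
  have hCba : (0 : ℝ) < (n - b).choose a := by exact_mod_cast Nat.choose_pos hab'
  -- expand the logarithm
  have hlog : Real.log (lam ^ (a + b) * (n.choose a) * (n.choose b) *
      (((n - b).choose a : ℝ) / (n.choose a)) ^ d) =
      (a + b) * Real.log lam + Real.log (n.choose a) + Real.log (n.choose b) +
        d * (Real.log ((n - b).choose a) - Real.log (n.choose a)) := by
    rw [Real.log_mul (by positivity) (by positivity), Real.log_mul (by positivity) hCb.ne',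
      Real.log_mul (by positivity) hCa.ne', Real.log_pow, Real.log_pow,
      Real.log_div hCba.ne' hCa.ne']
    push_cast
    ring
  -- the five entropy estimates
  have u1 := log_choose_le_entropy n a ha
  have l1 := entropy_sub_le_log_choose n a hn ha
  have u2 := log_choose_le_entropy n b hb
  have l2 := entropy_sub_le_log_choose n b hn hb
  have u3 := log_choose_le_entropy (n - b) a hab'
  -- the lower bound for `C(n-b, a)` needs `n - b ≥ 1` unless `a = 0`
  have l3 : ((n - b : ℕ) : ℝ) * Real.log ((n - b : ℕ) : ℝ) - a * Real.log a -
      (((n - b : ℕ) : ℝ) - a) * Real.log (((n - b : ℕ) : ℝ) - a) - Real.log n / 2 - 1 ≤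
      Real.log ((n - b).choose a) := by
    rcases Nat.eq_zero_or_pos (n - b) with h0 | hpos
    · have ha0 : a = 0 := by omega
      rw [h0, ha0]
      simp
      linarith
    · have := entropy_sub_le_log_choose (n - b) a hpos hab'
      have hmono : Real.log ((n - b : ℕ) : ℝ) ≤ Real.log n :=
        Real.log_le_log (by exact_mod_cast hpos) (by exact_mod_cast Nat.sub_le n b)
      linarith
  have hcast : ((n - b : ℕ) : ℝ) = (n : ℝ) - b := Nat.cast_sub hb
  rw [hcast, show (n : ℝ) - b - a = n - a - b by ring] at u3 l3
  rw [hlog, natMul_slyPhi1_div d lam hn a b, abs_le]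
  have hd0 : (0 : ℝ) ≤ d := Nat.cast_nonneg d
  have p1 := mul_le_mul_of_nonneg_left u1 hd0
  have p2 := mul_le_mul_of_nonneg_left l1 hd0
  have p3 := mul_le_mul_of_nonneg_left u3 hd0
  have p4 := mul_le_mul_of_nonneg_left l3 hd0
  constructor
  · nlinarith [p1, p2, p3, p4]
  · nlinarith [p1, p2, p3, p4]

end FirstMomentEntropy

/-! ### A crude upper bound for Sly's first moment (all `(a, b)`, boundary included)

`E Z^{a,b}(η) ≤ λ^{η⁺+η⁻} (n+m')^{(d-1)m'} E Z^{a,b}_{MWW}`: adding `m'` vertices per side multiplies an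
avoidance probability by at most `(n+m')^{m'}`, and occupying more vertices only lowers it. -/

section SlyFirstMomentBound

/-- One more vertex on each side at most multiplies the avoidance probability by `M + 1`:
`C(M+1-b, a)/C(M+1, a) ≤ (M+1) · C(M-b, a)/C(M, a)` for `a + b ≤ M`. [folklore] -/
theorem choose_div_choose_succ_le {M a b : ℕ} (h : a + b ≤ M) :
    (((M + 1 - b).choose a : ℝ) / ((M + 1).choose a)) ≤
      ((M : ℝ) + 1) * (((M - b).choose a : ℝ) / (M.choose a)) := by
  have haM : a ≤ M := by omega
  have h1 : (((M - b).choose a : ℕ) : ℝ) * ((M - b : ℕ) + 1) =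
      (((M - b + 1).choose a : ℕ) : ℝ) * ((M - b : ℕ) + 1 - a) := by
    have := Nat.choose_mul_succ_eq (M - b) a
    have hle : a ≤ M - b + 1 := by omega
    have e : ((M - b + 1 - a : ℕ) : ℝ) = ((M - b : ℕ) : ℝ) + 1 - a := by
      rw [Nat.cast_sub hle]; push_cast; ring
    rw [← e]
    exact_mod_cast this
  have h2 : ((M.choose a : ℕ) : ℝ) * ((M : ℝ) + 1) = (((M + 1).choose a : ℕ) : ℝ) * ((M : ℝ) + 1 - a) := by
    have := Nat.choose_mul_succ_eq M a
    have e : ((M + 1 - a : ℕ) : ℝ) = (M : ℝ) + 1 - a := by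
      rw [Nat.cast_sub (by omega)]; push_cast; ring
    rw [← e]
    exact_mod_cast this
  have hMb : ((M - b : ℕ) : ℝ) = (M : ℝ) - b := Nat.cast_sub (by omega)
  rw [hMb] at h1
  rw [show M + 1 - b = M - b + 1 by omega]
  have hC1 : (0 : ℝ) < (M + 1).choose a := by exact_mod_cast Nat.choose_pos (by omega)
  have hC2 : (0 : ℝ) < M.choose a := by exact_mod_cast Nat.choose_pos haM
  have hC3 : (0 : ℝ) ≤ (M - b).choose a := Nat.cast_nonneg _
  have hab : ((a : ℝ) + b) ≤ M := by exact_mod_cast h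
  have ha0 : (0 : ℝ) ≤ a := Nat.cast_nonneg a
  have hb0 : (0 : ℝ) ≤ b := Nat.cast_nonneg b
  rw [div_le_iff₀ hC1, show ((M : ℝ) + 1) * ((((M - b).choose a : ℕ) : ℝ) / (M.choose a)) * ((M + 1).choose a) =
    ((M : ℝ) + 1) * ((M - b).choose a) * ((M + 1).choose a) / (M.choose a) by ring, le_div_iff₀ hC2]
  -- `C(M-b+1,a) C(M,a) ≤ (M+1) C(M-b,a) C(M+1,a)`, after multiplying by `u v > 0`
  have hu : (0 : ℝ) < (M : ℝ) - b + 1 - a := by linarith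
  have hv : (0 : ℝ) < (M : ℝ) + 1 - a := by linarith
  have hineq : ((M : ℝ) - b + 1) * ((M : ℝ) + 1 - a) ≤ ((M : ℝ) + 1) ^ 2 * ((M : ℝ) - b + 1 - a) := by
    nlinarith [mul_nonneg (sq_nonneg ((M : ℝ) + 1)) (show (0 : ℝ) ≤ (M : ℝ) - a - b by linarith),
      mul_nonneg ha0 (show (0 : ℝ) ≤ (M : ℝ) + 1 - b by linarith), mul_nonneg ha0 hb0]
  have eq1 : (((M - b + 1).choose a : ℕ) : ℝ) * (M.choose a) * (((M : ℝ) - b + 1 - a) * ((M : ℝ) + 1 - a)) =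
      (((M - b).choose a : ℕ) : ℝ) * ((M : ℝ) - b + 1) * (M.choose a) * ((M : ℝ) + 1 - a) := by
    rw [h1]; ring
  have eq2 : ((M : ℝ) + 1) * ((M - b).choose a) * ((M + 1).choose a) * (((M : ℝ) - b + 1 - a) * ((M : ℝ) + 1 - a)) =
      ((M : ℝ) + 1) * ((M - b).choose a) * ((M.choose a) * ((M : ℝ) + 1)) * ((M : ℝ) - b + 1 - a) := by
    rw [h2]; ring
  refine le_of_mul_le_mul_right ?_ (mul_pos hu hv)
  rw [eq1, eq2]
  have hYQ : (0 : ℝ) ≤ (((M - b).choose a : ℕ) : ℝ) * (M.choose a) := mul_nonneg hC3 hC2.le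
  nlinarith [mul_le_mul_of_nonneg_left hineq hYQ]

/-- `m'` more vertices on each side at most multiply the avoidance probability by `(n+m')^{m'}`:
`C(n+m'-b, a)/C(n+m', a) ≤ (n+m')^{m'} · C(n-b, a)/C(n, a)` for `a + b ≤ n`. [folklore] -/
theorem choose_div_choose_add_le {n a b : ℕ} (h : a + b ≤ n) (m : ℕ) :
    (((n + m - b).choose a : ℝ) / ((n + m).choose a)) ≤
      ((n : ℝ) + m) ^ m * (((n - b).choose a : ℝ) / (n.choose a)) := by
  induction m with
  | zero => simp
  | succ m ih =>
    have hstep := choose_div_choose_succ_le (M := n + m) (a := a) (b := b) (by omega)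
    rw [show n + (m + 1) = n + m + 1 by ring]
    have hpos : (0 : ℝ) ≤ ((n - b).choose a : ℝ) / (n.choose a) := by positivity
    have hnm : (0 : ℝ) ≤ (n : ℝ) + m := by positivity
    calc (((n + m + 1 - b).choose a : ℝ) / ((n + m + 1).choose a))
        ≤ (((n + m : ℕ) : ℝ) + 1) * ((((n + m - b).choose a : ℝ) / ((n + m).choose a))) := hstep
      _ ≤ (((n + m : ℕ) : ℝ) + 1) * (((n : ℝ) + m) ^ m * (((n - b).choose a : ℝ) / (n.choose a))) :=
          mul_le_mul_of_nonneg_left ih (by positivity)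
      _ ≤ ((n : ℝ) + (m + 1 : ℕ)) ^ (m + 1) * (((n - b).choose a : ℝ) / (n.choose a)) := by
          push_cast
          rw [pow_succ]
          have h1 : ((n : ℝ) + m) ^ m ≤ ((n : ℝ) + (m + 1)) ^ m :=
            pow_le_pow_left₀ hnm (by linarith) m
          nlinarith [mul_le_mul_of_nonneg_right h1 hpos, pow_nonneg hnm m,
            mul_nonneg (pow_nonneg (by positivity : (0:ℝ) ≤ (n : ℝ) + (m + 1)) m) hpos]

/-- The avoidance probability decreases with the sizes: `C(N-B, A)/C(N, A) ≤ C(N-b, a)/C(N, a)`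
for `b ≤ B`, `a ≤ A`. [folklore] -/
theorem choose_div_choose_anti {N a b A B : ℕ} (hb : b ≤ B) (ha : a ≤ A) (haN : A ≤ N) :
    (((N - B).choose A : ℝ) / (N.choose A)) ≤ (((N - b).choose a : ℝ) / (N.choose a)) := by
  -- monotone in the avoided set
  have step1 : (((N - B).choose A : ℝ) / (N.choose A)) ≤ (((N - b).choose A : ℝ) / (N.choose A)) := by
    apply div_le_div_of_nonneg_right _ (Nat.cast_nonneg _)
    exact_mod_cast Nat.choose_le_choose A (by omega)
  -- antitone in the occupied set: one element at a time
  have step2 : ∀ A' : ℕ, A' + 1 ≤ N →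
      (((N - b).choose (A' + 1) : ℝ) / (N.choose (A' + 1))) ≤ (((N - b).choose A' : ℝ) / (N.choose A')) := by
    intro A' hA'
    have e1 : (((N - b).choose (A' + 1) : ℕ) : ℝ) * ((A' : ℝ) + 1) =
        (((N - b).choose A' : ℕ) : ℝ) * (((N - b : ℕ) : ℝ) - A') := by
      have := Nat.choose_succ_right_eq (N - b) A'
      rcases le_or_gt A' (N - b) with hle | hlt
      · rw [← Nat.cast_sub hle]; exact_mod_cast this
      · rw [Nat.choose_eq_zero_of_lt hlt, Nat.choose_eq_zero_of_lt (by omega)]; simp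
    have e2 : ((N.choose (A' + 1) : ℕ) : ℝ) * ((A' : ℝ) + 1) = ((N.choose A' : ℕ) : ℝ) * ((N : ℝ) - A') := by
      have := Nat.choose_succ_right_eq N A'
      rw [← Nat.cast_sub (by omega)]; exact_mod_cast this
    have hC1 : (0 : ℝ) < N.choose (A' + 1) := by exact_mod_cast Nat.choose_pos hA'
    have hC2 : (0 : ℝ) < N.choose A' := by exact_mod_cast Nat.choose_pos (by omega)
    have hC3 : (0 : ℝ) ≤ (N - b).choose A' := Nat.cast_nonneg _
    have hC4 : (0 : ℝ) ≤ (N - b).choose (A' + 1) := Nat.cast_nonneg _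
    have hNb : ((N - b : ℕ) : ℝ) ≤ N := by exact_mod_cast Nat.sub_le N b
    have hA'N : (A' : ℝ) + 1 ≤ N := by exact_mod_cast hA'
    rw [div_le_div_iff₀ hC1 hC2]
    -- `C(N-b,A'+1) C(N,A') (A'+1) = C(N-b,A') (N-b-A') C(N,A')` and `C(N,A'+1)(A'+1) = C(N,A')(N-A')`
    nlinarith [e1, e2, mul_nonneg hC3 hC2.le]
  have step3 : ∀ t : ℕ, a + t ≤ N →
      (((N - b).choose (a + t) : ℝ) / (N.choose (a + t))) ≤ (((N - b).choose a : ℝ) / (N.choose a)) := by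
    intro t
    induction t with
    | zero => intro; simp
    | succ t ih =>
      intro ht
      calc (((N - b).choose (a + (t + 1)) : ℝ) / (N.choose (a + (t + 1))))
          ≤ (((N - b).choose (a + t) : ℝ) / (N.choose (a + t))) := step2 (a + t) (by omega)
        _ ≤ _ := ih (by omega)
  obtain ⟨t, rfl⟩ := Nat.exists_eq_add_of_le ha
  exact step1.trans (step3 t haN)

/-- **Crude upper bound for Sly's first moment, uniformly in `(a, b)`.** With `k = d - 1`, `m'` extra
vertices `U` per side and a boundary configuration occupying `η⁺`, `η⁻` of them,
`E Z^{a,b}(η) ≤ λ^{η⁺+η⁻} (n+m')^{k m'} E Z^{a,b}_{MWW}` for all `a + b ≤ n` (ratio of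
`sly_firstMoment` to `mww_firstMoment`: `choose_div_choose_anti`, `choose_div_choose_add_le`) —
the polynomial-in-`n^{m'}` slack is harmless off the dominant window, where Sly's Lemma 3.3 only needs
`exp(-Ω(√n))`-small contributions and `m' log n = o(√n)`. [cite: Sly2010, proof of Lemma 3.3 (eq. (e:gtEZ2): the terms with `‖(α,β) - (p⁺,p⁻)‖_∞ > n^{-1/(2ℓ)}`)] -/
theorem slyFirstMoment_le_mul_mww {n m' k a b ep em : ℕ} {lam : ℝ} (hlam : 0 < lam)
    (hab : a + b ≤ n) :
    lam ^ (a + b + ep + em) * (n.choose a) * (n.choose b) *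
        (((n + m' - (b + em)).choose (a + ep) : ℝ) / ((n + m').choose (a + ep))) ^ k *
        (((n - b).choose a : ℝ) / (n.choose a)) ≤
      lam ^ (ep + em) * ((n : ℝ) + m') ^ (k * m') *
        (lam ^ (a + b) * (n.choose a) * (n.choose b) * (((n - b).choose a : ℝ) / (n.choose a)) ^ (k + 1)) := by
  have hr0 : (0 : ℝ) ≤ ((n - b).choose a : ℝ) / (n.choose a) := by positivity
  have hratio : (((n + m' - (b + em)).choose (a + ep) : ℝ) / ((n + m').choose (a + ep))) ≤
      ((n : ℝ) + m') ^ m' * (((n - b).choose a : ℝ) / (n.choose a)) := by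
    rcases le_or_gt (a + ep) (n + m') with hA | hA
    · calc (((n + m' - (b + em)).choose (a + ep) : ℝ) / ((n + m').choose (a + ep)))
          ≤ (((n + m' - b).choose a : ℝ) / ((n + m').choose a)) :=
            choose_div_choose_anti (by omega) (by omega) hA
        _ ≤ ((n : ℝ) + m') ^ m' * (((n - b).choose a : ℝ) / (n.choose a)) :=
            choose_div_choose_add_le hab m'
    · rw [Nat.choose_eq_zero_of_lt (by omega : n + m' - (b + em) < a + ep)]
      simp only [Nat.cast_zero, zero_div]
      positivity
  have hratio0 : (0 : ℝ) ≤ (((n + m' - (b + em)).choose (a + ep) : ℝ) / ((n + m').choose (a + ep))) := by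
    positivity
  have hpow : (((n + m' - (b + em)).choose (a + ep) : ℝ) / ((n + m').choose (a + ep))) ^ k ≤
      (((n : ℝ) + m') ^ m') ^ k * (((n - b).choose a : ℝ) / (n.choose a)) ^ k := by
    rw [← mul_pow]
    exact pow_le_pow_left₀ hratio0 hratio k
  rw [← pow_mul] at hpow
  have hC : (0 : ℝ) ≤ lam ^ (a + b + ep + em) * (n.choose a) * (n.choose b) := by positivity
  calc lam ^ (a + b + ep + em) * (n.choose a) * (n.choose b) *
        (((n + m' - (b + em)).choose (a + ep) : ℝ) / ((n + m').choose (a + ep))) ^ k *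
        (((n - b).choose a : ℝ) / (n.choose a))
      ≤ lam ^ (a + b + ep + em) * (n.choose a) * (n.choose b) *
        (((n : ℝ) + m') ^ (m' * k) * (((n - b).choose a : ℝ) / (n.choose a)) ^ k) *
        (((n - b).choose a : ℝ) / (n.choose a)) := by
          apply mul_le_mul_of_nonneg_right _ hr0
          exact mul_le_mul_of_nonneg_left hpow hC
    _ = lam ^ (ep + em) * ((n : ℝ) + m') ^ (k * m') *
        (lam ^ (a + b) * (n.choose a) * (n.choose b) * (((n - b).choose a : ℝ) / (n.choose a)) ^ (k + 1)) := by
          rw [mul_comm m' k]; ring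

end SlyFirstMomentBound

/-! ### Preparations for Lemma 3.3: swapping the halves, port weights, local Lipschitz bounds -/

section Lemma33Prep

/-- `C(N,A) C(N-A,B) = C(N,B) C(N-B,A)` (both count ordered pairs of disjoint `A`- and `B`-subsets),
for `A, B ≤ N`. [folklore] -/
theorem choose_mul_choose_sub_comm {N A B : ℕ} (hA : A ≤ N) (hB : B ≤ N) :
    N.choose A * (N - A).choose B = N.choose B * (N - B).choose A := by
  rcases le_or_gt (A + B) N with h | h
  · have h1 := Nat.choose_mul (n := N) (k := A + B) (s := A) (Nat.le_add_right A B)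
    have h2 := Nat.choose_mul (n := N) (k := A + B) (s := B) (Nat.le_add_left B A)
    rw [Nat.add_sub_cancel_left] at h1
    rw [Nat.add_sub_cancel] at h2
    rw [← h1, ← h2, Nat.choose_symm_add]
  · rw [Nat.choose_eq_zero_of_lt (by omega : N - A < B), Nat.choose_eq_zero_of_lt (by omega : N - B < A)]
    simp

/-- The avoidance probability is symmetric in the two sides:
`C(N-B, A)/C(N, A) = C(N-A, B)/C(N, B)` for `A, B ≤ N`. [folklore] -/
theorem choose_div_choose_comm {N A B : ℕ} (hA : A ≤ N) (hB : B ≤ N) :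
    (((N - B).choose A : ℝ) / (N.choose A)) = (((N - A).choose B : ℝ) / (N.choose B)) := by
  have hCA : (0 : ℝ) < N.choose A := by exact_mod_cast Nat.choose_pos hA
  have hCB : (0 : ℝ) < N.choose B := by exact_mod_cast Nat.choose_pos hB
  rw [div_eq_div_iff hCA.ne' hCB.ne']
  have := choose_mul_choose_sub_comm hA hB
  have h' : ((N.choose A : ℕ) : ℝ) * ((N - A).choose B) = (N.choose B) * ((N - B).choose A) := by
    exact_mod_cast this
  linarith [h']

/-- **Swapping the two halves of `G̃`.** Sly's first moment `E Z^{a,b}(η⁺, η⁻)` (`sly_firstMoment`)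
is invariant under `(a, η⁺) ↔ (b, η⁻)` (relabel the plus and minus halves; the `d-1` big matchings and
the small one are symmetric): for `a, b ≤ n`, `η⁺, η⁻ ≤ m'`,
`F(a, b, η⁺, η⁻) = F(b, a, η⁻, η⁺)`. Hence `E Z⁻_{G̃}(η⁺,η⁻) = E Z⁺_{G̃}(η⁻,η⁺) - (diagonal terms)`, the
reduction of the minus phase to the plus phase in Sly's Lemma 3.3 ("The analogous bound holds for
`Z⁻_{G̃}(η)`"). [cite: Sly2010, proof of Lemma 3.3] -/
theorem slyFirstMoment_swap {n m' k a b ep em : ℕ} (lam : ℝ) (ha : a ≤ n) (hb : b ≤ n)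
    (hep : ep ≤ m') (hem : em ≤ m') :
    lam ^ (a + b + ep + em) * (n.choose a) * (n.choose b) *
        (((n + m' - (b + em)).choose (a + ep) : ℝ) / ((n + m').choose (a + ep))) ^ k *
        (((n - b).choose a : ℝ) / (n.choose a)) =
      lam ^ (b + a + em + ep) * (n.choose b) * (n.choose a) *
        (((n + m' - (a + ep)).choose (b + em) : ℝ) / ((n + m').choose (b + em))) ^ k *
        (((n - a).choose b : ℝ) / (n.choose b)) := by
  rw [choose_div_choose_comm (N := n + m') (by omega) (by omega), choose_div_choose_comm ha hb,
    show b + a + em + ep = a + b + ep + em by ring]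
  ring

/-- **The limit port weights.** At an asymmetric critical point `(p⁺, p⁻)` of `Φ₁`
(`λ u^d = p^{±}(1-p^{±})^{d-1}`, `u = 1-p⁺-p⁻`, `d = k+1`) the two bases of the main term of
Lemma 3.1 are `λ (u/(1-p⁻))^k = p⁻/u` and `λ (u/(1-p⁺))^k = p⁺/u` — Sly's
`(λ((1-p⁺-p⁻)/(1-p^{∓}))^{d-1}) = q^{∓}/(1-q^{∓})` with `q^{±} = p^{±}/(1-p^{∓})` (eq. (e:pqRelation2)),
since `q⁻/(1-q⁻) = p⁻/(1-p⁺-p⁻)`. [cite: Sly2010, §1.3 eq. (e:pqRelation2) and proof of Lemma 3.3 (eq. (e:gtEZ4))] -/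
theorem slyCritical_portWeight {k : ℕ} {lam pp pm : ℝ} (hpm : 0 < pm) (hpp : 0 < pp)
    (hsum : pp + pm < 1)
    (hEα : lam * (1 - pp - pm) ^ (k + 1) = pp * (1 - pp) ^ k)
    (hEβ : lam * (1 - pp - pm) ^ (k + 1) = pm * (1 - pm) ^ k) :
    lam * ((1 - pp - pm) / (1 - pm)) ^ k = pm / (1 - pp - pm) ∧
      lam * ((1 - pp - pm) / (1 - pp)) ^ k = pp / (1 - pp - pm) ∧
      pm / (1 - pp) / (1 - pm / (1 - pp)) = pm / (1 - pp - pm) ∧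
      pp / (1 - pm) / (1 - pp / (1 - pm)) = pp / (1 - pp - pm) := by
  have hu : 0 < 1 - pp - pm := by linarith
  have h1 : 0 < 1 - pm := by linarith
  have h2 : 0 < 1 - pp := by linarith
  refine ⟨?_, ?_, ?_, ?_⟩
  · rw [div_pow, ← mul_div_assoc, div_eq_div_iff (pow_ne_zero k h1.ne') hu.ne']
    calc lam * (1 - pp - pm) ^ k * (1 - pp - pm) = lam * (1 - pp - pm) ^ (k + 1) := by ring
      _ = pm * (1 - pm) ^ k := hEβ
  · rw [div_pow, ← mul_div_assoc, div_eq_div_iff (pow_ne_zero k h2.ne') hu.ne']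
    calc lam * (1 - pp - pm) ^ k * (1 - pp - pm) = lam * (1 - pp - pm) ^ (k + 1) := by ring
      _ = pp * (1 - pp) ^ k := hEα
  · have e : 1 - pm / (1 - pp) = (1 - pp - pm) / (1 - pp) := by
      rw [one_sub_div h2.ne']
    rw [e, div_div_div_cancel_right₀ h2.ne']
  · have e : 1 - pp / (1 - pm) = (1 - pp - pm) / (1 - pm) := by
      rw [one_sub_div h1.ne', show (1 : ℝ) - pm - pp = 1 - pp - pm by ring]
    rw [e, div_div_div_cancel_right₀ h1.ne']

/-- `Φ₁` is `C¹` (indeed analytic) at every interior point of the triangle. [folklore] -/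
theorem contDiffAt_slyPhi1 (d : ℕ) (lam : ℝ) {α β : ℝ} (hα : 0 < α) (hβ : 0 < β) (hαβ : α + β < 1)
    {m : WithTop ℕ∞} :
    ContDiffAt ℝ m (fun p : ℝ × ℝ => slyPhi1 d lam p.1 p.2) (α, β) := by
  have h1 : ContDiffAt ℝ m (fun p : ℝ × ℝ => p.1) (α, β) := contDiffAt_fst
  have h2 : ContDiffAt ℝ m (fun p : ℝ × ℝ => p.2) (α, β) := contDiffAt_snd
  have hl1 : ContDiffAt ℝ m (fun p : ℝ × ℝ => Real.log p.1) (α, β) := h1.log hα.ne'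
  have hl2 : ContDiffAt ℝ m (fun p : ℝ × ℝ => Real.log p.2) (α, β) := h2.log hβ.ne'
  have hu : ContDiffAt ℝ m (fun p : ℝ × ℝ => 1 - p.1 - p.2) (α, β) := (contDiffAt_const.sub h1).sub h2
  have hlu : ContDiffAt ℝ m (fun p : ℝ × ℝ => Real.log (1 - p.1 - p.2)) (α, β) :=
    hu.log (by simp; linarith)
  have ha1 : ContDiffAt ℝ m (fun p : ℝ × ℝ => 1 - p.1) (α, β) := contDiffAt_const.sub h1
  have hb1 : ContDiffAt ℝ m (fun p : ℝ × ℝ => 1 - p.2) (α, β) := contDiffAt_const.sub h2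
  have hla1 : ContDiffAt ℝ m (fun p : ℝ × ℝ => Real.log (1 - p.1)) (α, β) := ha1.log (by simp; linarith)
  have hlb1 : ContDiffAt ℝ m (fun p : ℝ × ℝ => Real.log (1 - p.2)) (α, β) := hb1.log (by simp; linarith)
  have e : (fun p : ℝ × ℝ => slyPhi1 d lam p.1 p.2) = fun p =>
      (p.1 + p.2) * Real.log lam - p.1 * Real.log p.1 - p.2 * Real.log p.2 -
        d * (1 - p.1 - p.2) * Real.log (1 - p.1 - p.2) +
        (d - 1) * ((1 - p.1) * Real.log (1 - p.1) + (1 - p.2) * Real.log (1 - p.2)) := by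
    funext p; rfl
  rw [e]
  exact ((((h1.add h2).mul contDiffAt_const).sub (h1.mul hl1)).sub (h2.mul hl2)).sub
    ((contDiffAt_const.mul hu).mul hlu) |>.add (contDiffAt_const.mul ((ha1.mul hla1).add (hb1.mul hlb1)))

/-- **`Φ₁` is Lipschitz near an interior point**: `|Φ₁(α,β) - Φ₁(α₀,β₀)| ≤ L max(|α-α₀|, |β-β₀|)`
on a small `ℓ_∞`-box (from `C¹`). Used at `(p⁺, p⁻)`: the nearest grid point `(⌊p⁺n⌋/n, ⌊p⁻n⌋/n)`
loses only `O(1/n)` in the exponent. [folklore] -/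
theorem slyPhi1_lipschitz_near (d : ℕ) (lam : ℝ) {α₀ β₀ : ℝ} (hα : 0 < α₀) (hβ : 0 < β₀)
    (hαβ : α₀ + β₀ < 1) :
    ∃ L r : ℝ, 0 < L ∧ 0 < r ∧ ∀ α β : ℝ, |α - α₀| ≤ r → |β - β₀| ≤ r →
      |slyPhi1 d lam α β - slyPhi1 d lam α₀ β₀| ≤ L * max |α - α₀| |β - β₀| := by
  obtain ⟨K, t, ht, hK⟩ := (contDiffAt_slyPhi1 d lam hα hβ hαβ (m := 1)).exists_lipschitzOnWith
  obtain ⟨r, hr0, hrt⟩ := Metric.mem_nhds_iff.1 ht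
  refine ⟨(K : ℝ) + 1, r / 2, by positivity, by linarith, fun α β hα' hβ' => ?_⟩
  have hmem : (α, β) ∈ t := hrt (by
    rw [Metric.mem_ball, Prod.dist_eq, Real.dist_eq, Real.dist_eq]
    exact max_lt (by linarith) (by linarith))
  have h0 : (α₀, β₀) ∈ t := hrt (Metric.mem_ball_self hr0)
  have := hK.dist_le_mul (α, β) hmem (α₀, β₀) h0
  rw [Real.dist_eq, Prod.dist_eq, Real.dist_eq, Real.dist_eq] at this
  have hm : 0 ≤ max |α - α₀| |β - β₀| := le_max_of_le_left (abs_nonneg _)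
  nlinarith

/-- **The coefficients of the main term of Lemma 3.1 are Lipschitz near `(p⁺, p⁻)`.** In the scaled
variables `α = a/n`, `β = b/n` the main term of `sly_lemma31_abs_log_ratio_sub_le` is
`k m' c₁(α,β) + η⁻ c₂(α,β) + η⁺ c₃(α,β)` with `c₁ = log(1-α) + log(1-β) - log(1-α-β)`,
`c₂ = log λ + k(log(1-α-β) - log(1-β))`, `c₃ = log λ + k(log(1-α-β) - log(1-α))`; the three basic
logarithms are Lipschitz on an `ℓ_∞`-box around any interior point: for `u₀ = 1-α₀-β₀ > 0` and
`|α-α₀|, |β-β₀| ≤ u₀/4`,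
`|log(1-α) - log(1-α₀)|, |log(1-β) - log(1-β₀)| ≤ (2/u₀) max(|α-α₀|,|β-β₀|)` and
`|log(1-α-β) - log u₀| ≤ (4/u₀) max(|α-α₀|,|β-β₀|)` (`|log x - log y| ≤ |x-y|/min(x,y)`). This is the
uniformity in `(α, β)` over the dominant window of Sly's (e:gtEZ3). [cite: Sly2010, proof of Lemma 3.3 (eq. (e:gtEZ3))] -/
theorem abs_log_sub_log_le_near {α₀ β₀ α β : ℝ} (hα0 : 0 ≤ α₀) (hβ0 : 0 ≤ β₀)
    (hu : 0 < 1 - α₀ - β₀)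
    (hα : |α - α₀| ≤ (1 - α₀ - β₀) / 4) (hβ : |β - β₀| ≤ (1 - α₀ - β₀) / 4) :
    |Real.log (1 - α) - Real.log (1 - α₀)| ≤ 2 / (1 - α₀ - β₀) * max |α - α₀| |β - β₀| ∧
      |Real.log (1 - β) - Real.log (1 - β₀)| ≤ 2 / (1 - α₀ - β₀) * max |α - α₀| |β - β₀| ∧
      |Real.log (1 - α - β) - Real.log (1 - α₀ - β₀)| ≤
        4 / (1 - α₀ - β₀) * max |α - α₀| |β - β₀| := by
  set u₀ : ℝ := 1 - α₀ - β₀ with hu₀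
  -- the basic two-sided logarithm estimate
  have key : ∀ x y : ℝ, 0 < x → 0 < y → |Real.log x - Real.log y| ≤ |x - y| / min x y := by
    intro x y hx hy
    have hm : 0 < min x y := lt_min hx hy
    rw [abs_le]
    constructor
    · -- `log x - log y ≥ 1 - y/x = (x - y)/x ≥ -|x-y|/min`
      have h1 := Real.one_sub_inv_le_log_of_pos (div_pos hx hy)
      rw [Real.log_div hx.ne' hy.ne', inv_div] at h1
      have h2 : 1 - y / x = (x - y) / x := by field_simp
      rw [h2] at h1
      have h3 : -(|x - y| / min x y) ≤ (x - y) / x := by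
        rw [neg_le, ← neg_div]
        calc -(x - y) / x ≤ |x - y| / x := by
              apply div_le_div_of_nonneg_right _ hx.le; exact neg_le_abs (x - y)
          _ ≤ |x - y| / min x y := div_le_div_of_nonneg_left (abs_nonneg _) hm (min_le_left _ _)
      linarith
    · have h1 := Real.log_le_sub_one_of_pos (div_pos hx hy)
      rw [Real.log_div hx.ne' hy.ne'] at h1
      have h2 : x / y - 1 = (x - y) / y := by field_simp
      rw [h2] at h1
      calc Real.log x - Real.log y ≤ (x - y) / y := h1
        _ ≤ |x - y| / y := div_le_div_of_nonneg_right (le_abs_self _) hy.le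
        _ ≤ |x - y| / min x y := div_le_div_of_nonneg_left (abs_nonneg _) hm (min_le_right _ _)
  have hαle := (abs_le.1 hα)
  have hβle := (abs_le.1 hβ)
  have hM : 0 ≤ max |α - α₀| |β - β₀| := le_max_of_le_left (abs_nonneg _)
  have hαM : |α - α₀| ≤ max |α - α₀| |β - β₀| := le_max_left _ _
  have hβM : |β - β₀| ≤ max |α - α₀| |β - β₀| := le_max_right _ _
  refine ⟨?_, ?_, ?_⟩
  · have hx : 0 < 1 - α := by linarith [hαle.2]
    have hy : 0 < 1 - α₀ := by linarith
    have hmin : u₀ / 2 ≤ min (1 - α) (1 - α₀) := le_min (by linarith [hαle.2]) (by linarith)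
    have h := key (1 - α) (1 - α₀) hx hy
    rw [show (1 - α) - (1 - α₀) = -(α - α₀) by ring, abs_neg] at h
    calc |Real.log (1 - α) - Real.log (1 - α₀)| ≤ |α - α₀| / min (1 - α) (1 - α₀) := h
      _ ≤ |α - α₀| / (u₀ / 2) := div_le_div_of_nonneg_left (abs_nonneg _) (by linarith) hmin
      _ = 2 / u₀ * |α - α₀| := by field_simp
      _ ≤ 2 / u₀ * max |α - α₀| |β - β₀| := mul_le_mul_of_nonneg_left hαM (by positivity)
  · have hx : 0 < 1 - β := by linarith [hβle.2]
    have hy : 0 < 1 - β₀ := by linarith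
    have hmin : u₀ / 2 ≤ min (1 - β) (1 - β₀) := le_min (by linarith [hβle.2]) (by linarith)
    have h := key (1 - β) (1 - β₀) hx hy
    rw [show (1 - β) - (1 - β₀) = -(β - β₀) by ring, abs_neg] at h
    calc |Real.log (1 - β) - Real.log (1 - β₀)| ≤ |β - β₀| / min (1 - β) (1 - β₀) := h
      _ ≤ |β - β₀| / (u₀ / 2) := div_le_div_of_nonneg_left (abs_nonneg _) (by linarith) hmin
      _ = 2 / u₀ * |β - β₀| := by field_simp
      _ ≤ 2 / u₀ * max |α - α₀| |β - β₀| := mul_le_mul_of_nonneg_left hβM (by positivity)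
  · have hx : 0 < 1 - α - β := by linarith [hαle.2, hβle.2]
    have hmin : u₀ / 2 ≤ min (1 - α - β) u₀ := le_min (by linarith [hαle.2, hβle.2]) (by linarith)
    have h := key (1 - α - β) u₀ hx hu
    have htri : |(1 - α - β) - u₀| ≤ |α - α₀| + |β - β₀| := by
      rw [show (1 - α - β) - u₀ = -((α - α₀) + (β - β₀)) by rw [hu₀]; ring, abs_neg]
      exact abs_add_le _ _
    have hmin0 : 0 < min (1 - α - β) u₀ := lt_min hx hu
    calc |Real.log (1 - α - β) - Real.log u₀| ≤ |(1 - α - β) - u₀| / min (1 - α - β) u₀ := h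
      _ ≤ (|α - α₀| + |β - β₀|) / min (1 - α - β) u₀ := div_le_div_of_nonneg_right htri hmin0.le
      _ ≤ (|α - α₀| + |β - β₀|) / (u₀ / 2) :=
          div_le_div_of_nonneg_left (by positivity) (by linarith) hmin
      _ ≤ 4 / u₀ * max |α - α₀| |β - β₀| := by
          rw [div_le_iff₀ (by linarith : (0:ℝ) < u₀ / 2)]
          have : (4 / u₀ * max |α - α₀| |β - β₀|) * (u₀ / 2) = 2 * max |α - α₀| |β - β₀| := by
            field_simp; ring
          rw [this]
          linarith

end Lemma33Prep

/-! ### The dominant windows (Sly, proof of Lemma 3.3, eq. (e:gtEZ2))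

Off the `ℓ_∞`-windows of radius `n^{-1/(2ℓ)}` around `(p⁺,p⁻)` and `(p⁻,p⁺)`, the exponent `n Φ₁(a/n, b/n)`
falls below its value at the anchor grid point `(⌊p⁺n⌋, ⌊p⁻n⌋)` by more than any
`K n^{γ'} log n + 2 log(n+1) + const`, `γ' < 1/2`, for large `n`. -/

section DominantWindow

open Asymptotics

/-- The comparison of scales behind Sly's (e:gtEZ2): for `C > 0`, `γ' < 1/2` and any `K, L`,
`-C √x + K x^{γ'} log x + 2 log x + L → -∞`. [folklore] -/
theorem tendsto_neg_sqrt_add_atBot {C K L γ' : ℝ} (hC : 0 < C) (hγ2 : γ' < 1 / 2) :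
    Tendsto (fun x : ℝ => -C * x ^ (1 / 2 : ℝ) + K * (x ^ γ' * Real.log x) + 2 * Real.log x + L)
      atTop atBot := by
  -- the remainder is `o(x^{1/2})`
  have h1 : (fun x : ℝ => x ^ γ' * Real.log x) =o[atTop] fun x => x ^ (1 / 2 : ℝ) := by
    have hlog : Real.log =o[atTop] fun x : ℝ => x ^ (1 / 2 - γ') :=
      isLittleO_log_rpow_atTop (by linarith)
    have hbig : (fun x : ℝ => x ^ γ') =O[atTop] fun x : ℝ => x ^ γ' := isBigO_refl _ _
    have h := hbig.mul_isLittleO hlog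
    refine h.congr' EventuallyEq.rfl ?_
    filter_upwards [eventually_gt_atTop 0] with x hx
    rw [← Real.rpow_add hx]
    norm_num
  have h2 : Real.log =o[atTop] fun x : ℝ => x ^ (1 / 2 : ℝ) := isLittleO_log_rpow_atTop (by norm_num)
  have hR : (fun x : ℝ => K * (x ^ γ' * Real.log x) + 2 * Real.log x) =o[atTop]
      fun x => x ^ (1 / 2 : ℝ) := (h1.const_mul_left K).add (h2.const_mul_left 2)
  have hbound := hR.bound (half_pos hC)
  -- hence the function is eventually `≤ -(C/2) x^{1/2} + L`
  have hev : ∀ᶠ x : ℝ in atTop, -C * x ^ (1 / 2 : ℝ) + K * (x ^ γ' * Real.log x) + 2 * Real.log x + L ≤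
      -(C / 2) * x ^ (1 / 2 : ℝ) + L := by
    filter_upwards [hbound, eventually_ge_atTop 0] with x hx hx0
    rw [Real.norm_eq_abs, Real.norm_eq_abs, abs_of_nonneg (Real.rpow_nonneg hx0 _)] at hx
    have := le_abs_self (K * (x ^ γ' * Real.log x) + 2 * Real.log x)
    linarith
  have hmain : Tendsto (fun x : ℝ => -(C / 2) * x ^ (1 / 2 : ℝ) + L) atTop atBot := by
    have h := (tendsto_rpow_atTop (by norm_num : (0 : ℝ) < 1 / 2)).const_mul_atTop (half_pos hC)
    have h' : Tendsto (fun x : ℝ => -(C / 2) * x ^ (1 / 2 : ℝ)) atTop atBot := by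
      have := tendsto_neg_atTop_atBot.comp h
      refine this.congr fun x => ?_
      simp only [Function.comp]
      ring
    exact tendsto_atBot_add_const_right _ L h'
  exact tendsto_atBot_mono' atTop hev hmain

/-- A floor anchor is within `1/n`: `|⌊p n⌋₊/n - p| ≤ 1/n` for `p ≥ 0`, `n ≥ 1`. [folklore] -/
theorem abs_floor_div_sub_le {p : ℝ} (hp : 0 ≤ p) {n : ℕ} (hn : 1 ≤ n) :
    |(⌊p * n⌋₊ : ℝ) / n - p| ≤ 1 / n := by
  have hn0 : (0 : ℝ) < n := by exact_mod_cast hn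
  have h1 : (⌊p * n⌋₊ : ℝ) ≤ p * n := Nat.floor_le (by positivity)
  have h2 : p * n < (⌊p * n⌋₊ : ℝ) + 1 := Nat.lt_floor_add_one _
  rw [show (⌊p * n⌋₊ : ℝ) / n - p = ((⌊p * n⌋₊ : ℝ) - p * n) / n by field_simp, abs_div,
    abs_of_pos hn0, div_le_div_iff_of_pos_right hn0, abs_le]
  constructor <;> linarith

/-- **Off the dominant windows, `n Φ₁` loses more than `√n`** (the core of Sly's (e:gtEZ2),
"`Σ_{α ≥ β, ‖(α,β)-(p⁺,p⁻)‖_∞ > n^{-1/(2ℓ)}} Z^{α,β}_{G̃}(η) ≤ exp(-(C/2) n^{1/2}) E Z⁺_{G̃}(η)`"): for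
`d ≥ 3`, `λ > λ_c(𝕋_d)` and the asymmetric critical point `(p⁺, p⁻)` there is `ℓ ≥ 1` such that for
all `K`, all `0 < γ' < 1/2` and all `ε > 0`, for all large `n` and every grid point `(a, b)`,
`a + b ≤ n`, at `ℓ_∞`-distance `> n^{-1/(2ℓ)}` (in the scaled variables `a/n, b/n`) from both
`(p⁺, p⁻)` and `(p⁻, p⁺)`:
`n Φ₁(a/n, b/n) + K n^{γ'} log n + 2 log(n+1) ≤ n Φ₁(⌊p⁺n⌋/n, ⌊p⁻n⌋/n) + log ε`.
So any `(n+1)²` such terms of size `≤ exp(n Φ₁ + K n^{γ'} log n)` sum to at most `ε` times a single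
term of size `≥ exp(n Φ₁ - K n^{γ'} log n)` at the anchor. Ingredients: the power-law gap
`C n^{-1/2}` on the annulus (`slyPhi1_local_gap`, also at the mirror by `slyPhi1_comm`), the uniform gap
outside (`slyPhi1_uniform_gap`), the `O(1/n)` loss at the anchor (`slyPhi1_lipschitz_near`), and
`-C√n + K n^{γ'} log n + 2 log n → -∞` (`tendsto_neg_sqrt_add_atBot`).
[cite: Sly2010, proof of Lemma 3.3 (eq. (e:gtEZ2))] -/
theorem slyPhi1_offWindow {d : ℕ} (hd : 3 ≤ d) {lam pp pm : ℝ} (hlam : hardCoreThreshold d < lam)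
    (hpm : 0 < pm) (hlt : pm < pp) (hsum : pp + pm < 1)
    (hEα : lam * (1 - pp - pm) ^ d = pp * (1 - pp) ^ (d - 1))
    (hEβ : lam * (1 - pp - pm) ^ d = pm * (1 - pm) ^ (d - 1)) :
    ∃ ℓ : ℕ, 1 ≤ ℓ ∧ ∀ K γ' ε : ℝ, γ' < 1 / 2 → 0 < ε →
      ∃ n₀ : ℕ, ∀ n : ℕ, n₀ ≤ n → ∀ a b : ℕ, a + b ≤ n →
        (n : ℝ) ^ (-(1 / (2 * (ℓ : ℝ)))) < max |(a : ℝ) / n - pp| |(b : ℝ) / n - pm| →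
        (n : ℝ) ^ (-(1 / (2 * (ℓ : ℝ)))) < max |(a : ℝ) / n - pm| |(b : ℝ) / n - pp| →
          n * slyPhi1 d lam (a / n) (b / n) + K * ((n : ℝ) ^ γ' * Real.log n) + 2 * Real.log (n + 1) ≤
            n * slyPhi1 d lam (⌊pp * n⌋₊ / n) (⌊pm * n⌋₊ / n) + Real.log ε := by
  set M : ℝ := slyPhi1 d lam pp pm with hM
  obtain ⟨ℓ₀, C, ε₁, hC, hε₁, hgap⟩ := slyPhi1_local_gap hd hlam hpm hlt hsum hEα hEβ
  set ℓ : ℕ := max ℓ₀ 1 with hℓ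
  have hℓ1 : 1 ≤ ℓ := le_max_right _ _
  have hℓ₀ : ℓ₀ ≤ ℓ := le_max_left _ _
  have hℓR : (0 : ℝ) < ℓ := by exact_mod_cast hℓ1
  set ε₂ : ℝ := min ε₁ 1 with hε₂
  have hε₂0 : 0 < ε₂ := lt_min hε₁ one_pos
  obtain ⟨δ, hδ, hunif⟩ := slyPhi1_uniform_gap hd hlam hpm hlt hsum hEα hEβ hε₂0
  obtain ⟨L, r, hL, hr, hlip⟩ := slyPhi1_lipschitz_near d lam (hpm.trans hlt) hpm hsum
  refine ⟨ℓ, hℓ1, fun K γ' ε hγ2 hε => ?_⟩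
  -- the four largeness conditions on `n`
  have ev1 : ∀ᶠ n : ℕ in atTop, (n : ℝ) ^ (-(1 / (2 * (ℓ : ℝ)))) < ε₂ :=
    ((tendsto_rpow_neg_atTop (by positivity : (0 : ℝ) < 1 / (2 * (ℓ : ℝ)))).comp
      tendsto_natCast_atTop_atTop).eventually (gt_mem_nhds hε₂0)
  have ev2 : ∀ᶠ n : ℕ in atTop, C * (n : ℝ) ^ (-(1 / 2 : ℝ)) ≤ δ := by
    have h := ((tendsto_rpow_neg_atTop (by norm_num : (0 : ℝ) < 1 / 2)).comp
      tendsto_natCast_atTop_atTop).const_mul C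
    rw [mul_zero] at h
    exact h.eventually (eventually_le_nhds hδ)
  have ev3 : ∀ᶠ n : ℕ in atTop, (1 : ℝ) / n ≤ r :=
    tendsto_one_div_atTop_nhds_zero_nat.eventually (eventually_le_nhds hr)
  have ev4 : ∀ᶠ n : ℕ in atTop, -C * (n : ℝ) ^ (1 / 2 : ℝ) + K * ((n : ℝ) ^ γ' * Real.log n) +
      2 * Real.log n + (2 * Real.log 2 + L) ≤ Real.log ε :=
    ((tendsto_neg_sqrt_add_atBot (K := K) (L := 2 * Real.log 2 + L) hC hγ2).comp
      tendsto_natCast_atTop_atTop).eventually (eventually_le_atBot _)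
  obtain ⟨n₀, hn₀⟩ := eventually_atTop.1 (ev1.and (ev2.and (ev3.and (ev4.and (eventually_ge_atTop 1)))))
  refine ⟨n₀, fun n hn a b hab hoff1 hoff2 => ?_⟩
  obtain ⟨h1, h2, h3, h4, hn1⟩ := hn₀ n hn
  have hn0 : (0 : ℝ) < n := by exact_mod_cast hn1
  set α : ℝ := (a : ℝ) / n with hαdef
  set β : ℝ := (b : ℝ) / n with hβdef
  have hα0 : 0 ≤ α := by positivity
  have hβ0 : 0 ≤ β := by positivity
  have hαβ : α + β ≤ 1 := by
    rw [hαdef, hβdef, ← add_div, div_le_one hn0]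
    exact_mod_cast hab
  -- Step 1: the gap `C n^{-1/2}` off both windows
  have hρℓ : ((n : ℝ) ^ (-(1 / (2 * (ℓ : ℝ))))) ^ ℓ = (n : ℝ) ^ (-(1 / 2 : ℝ)) := by
    rw [← Real.rpow_natCast, ← Real.rpow_mul hn0.le]
    congr 1
    field_simp
  have hρ0 : 0 ≤ (n : ℝ) ^ (-(1 / (2 * (ℓ : ℝ)))) := Real.rpow_nonneg hn0.le _
  have hgapn : slyPhi1 d lam α β + C * (n : ℝ) ^ (-(1 / 2 : ℝ)) ≤ M := by
    by_cases hA : max |α - pp| |β - pm| ≤ ε₂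
    · have hg := hgap α β hα0 hβ0 hαβ ((le_max_left _ _).trans (hA.trans (min_le_left _ _)))
        ((le_max_right _ _).trans (hA.trans (min_le_left _ _)))
      have hm0 : 0 ≤ max |α - pp| |β - pm| := le_max_of_le_left (abs_nonneg _)
      have hpow1 : max |α - pp| |β - pm| ^ ℓ ≤ max |α - pp| |β - pm| ^ ℓ₀ :=
        pow_le_pow_of_le_one hm0 (hA.trans (min_le_right _ _)) hℓ₀
      have hpow2 : ((n : ℝ) ^ (-(1 / (2 * (ℓ : ℝ))))) ^ ℓ ≤ max |α - pp| |β - pm| ^ ℓ :=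
        pow_le_pow_left₀ hρ0 hoff1.le ℓ
      rw [hρℓ] at hpow2
      have hCle := mul_le_mul_of_nonneg_left (hpow2.trans hpow1) hC.le
      linarith only [hg, hCle]
    · by_cases hB : max |α - pm| |β - pp| ≤ ε₂
      · have hg := hgap β α hβ0 hα0 (by linarith) ((le_max_right _ _).trans (hB.trans (min_le_left _ _)))
          ((le_max_left _ _).trans (hB.trans (min_le_left _ _)))
        rw [max_comm] at hg
        have hm0 : 0 ≤ max |α - pm| |β - pp| := le_max_of_le_left (abs_nonneg _)
        have hpow1 : max |α - pm| |β - pp| ^ ℓ ≤ max |α - pm| |β - pp| ^ ℓ₀ :=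
          pow_le_pow_of_le_one hm0 (hB.trans (min_le_right _ _)) hℓ₀
        have hpow2 : ((n : ℝ) ^ (-(1 / (2 * (ℓ : ℝ))))) ^ ℓ ≤ max |α - pm| |β - pp| ^ ℓ :=
          pow_le_pow_left₀ hρ0 hoff2.le ℓ
        rw [hρℓ] at hpow2
        rw [slyPhi1_comm]
        have hCle := mul_le_mul_of_nonneg_left (hpow2.trans hpow1) hC.le
        linarith only [hg, hCle]
      · push Not at hA hB
        have hu := hunif α β hα0 hβ0 hαβ hA.le hB.le
        linarith only [hu, h2]
  -- Step 2: the anchor loses at most `L`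
  have ha₀ := abs_floor_div_sub_le (hpm.trans hlt).le hn1
  have hb₀ := abs_floor_div_sub_le hpm.le hn1
  have hanchor : (n : ℝ) * M - L ≤ n * slyPhi1 d lam (⌊pp * n⌋₊ / n) (⌊pm * n⌋₊ / n) := by
    have h := hlip (⌊pp * n⌋₊ / n) (⌊pm * n⌋₊ / n) (ha₀.trans h3) (hb₀.trans h3)
    have hmax : max |(⌊pp * n⌋₊ : ℝ) / n - pp| |(⌊pm * n⌋₊ : ℝ) / n - pm| ≤ 1 / n := max_le ha₀ hb₀
    have h' : |slyPhi1 d lam (⌊pp * n⌋₊ / n) (⌊pm * n⌋₊ / n) - M| ≤ L * (1 / n) :=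
      h.trans (mul_le_mul_of_nonneg_left hmax hL.le)
    rw [abs_le] at h'
    have e : (n : ℝ) * (L * (1 / n)) = L := by field_simp
    have hmul := mul_le_mul_of_nonneg_left h'.1 hn0.le
    rw [mul_neg, e, mul_sub] at hmul
    linarith only [hmul]
  -- Step 3: combine
  have hsqrt : (n : ℝ) * (n : ℝ) ^ (-(1 / 2 : ℝ)) = (n : ℝ) ^ (1 / 2 : ℝ) := by
    rw [show (1 / 2 : ℝ) = 1 + -(1 / 2) by norm_num, Real.rpow_add hn0, Real.rpow_one]
    norm_num
  have hlog2 : Real.log ((n : ℝ) + 1) ≤ Real.log 2 + Real.log n := by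
    rw [← Real.log_mul two_ne_zero hn0.ne']
    exact Real.log_le_log (by positivity) (by linarith [show (1 : ℝ) ≤ n by exact_mod_cast hn1])
  have hstep : (n : ℝ) * slyPhi1 d lam α β ≤ n * M - C * (n : ℝ) ^ (1 / 2 : ℝ) := by
    have := mul_le_mul_of_nonneg_left hgapn hn0.le
    rw [mul_add, ← mul_assoc, mul_comm (n : ℝ) C, mul_assoc, hsqrt] at this
    linarith only [this]
  linarith only [hstep, hlog2, h4, hanchor]

end DominantWindow

/-! ### Sly's Lemma 3.3 (first-moment form), proved

The sum manipulation: on the dominant window `E Z^{a,b}_{G̃}(η)/E Z^{a,b}_{MWW} = e^{G₀(η) ± τ_n}`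
(`G₀(η) = (d-1) m' log C₀ + η⁻ log(p⁻/u*) + η⁺ log(p⁺/u*)`, `τ_n → 0` for `m' ≤ n^γ`); off the windows every
term is `≤ ε (n+1)^{-2}` times the anchor term, uniformly in `η`; the minus phase is the plus phase with
the halves swapped, minus the negligible diagonal. Conclusion `sly_lemma33`:
`|E Z^{±}_{G̃}(η) - A W^{±}(η)| ≤ ε A W^{±}(η)` with `W⁺(η) = (p⁺/u*)^{η⁺}(p⁻/u*)^{η⁻}`, `W⁻(η) = W⁺(η̄)`,
`A = C₀^{(d-1)m'} E Z⁺_{MWW}`, for all large `n`, all `m' ≤ n^γ`, all `η^{±} ≤ m'`. -/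

section Lemma33

open Finset

/-- **Swapping the halves**, for the named first moment: `slyF n m' k λ a b η⁺ η⁻ = slyF n m' k λ b a η⁻ η⁺`
for `a, b ≤ n`, `η⁺, η⁻ ≤ m'` (`slyFirstMoment_swap`). [cite: Sly2010, proof of Lemma 3.3] -/
theorem slyF_swap {n m' k a b ep em : ℕ} (lam : ℝ) (ha : a ≤ n) (hb : b ≤ n) (hep : ep ≤ m')
    (hem : em ≤ m') : slyF n m' k lam a b ep em = slyF n m' k lam b a em ep := by
  rw [slyF_def, slyF_def, slyFirstMoment_swap lam ha hb hep hem]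

/-- **The minus phase through the plus phase**: `E Z⁻_{G̃}(η⁺, η⁻) = E Z⁺_{G̃}(η⁻, η⁺) - Σ_a E Z^{a,a}(η⁻, η⁺)`
(swap the halves; the diagonal `a = b` belongs to the plus phase), for `η^{±} ≤ m'`.
[cite: Sly2010, proof of Lemma 3.3 ("because of the slight asymmetry in the definition of `Z⁺_{G̃}` and `Z⁻_{G̃}` …")] -/
theorem slyZminus_eq_slyZplus_sub {n m' k ep em : ℕ} (lam : ℝ) (hep : ep ≤ m') (hem : em ≤ m') :
    slyZminus n m' k lam ep em =
      slyZplus n m' k lam em ep - ∑ a ∈ range (n + 1), slyF n m' k lam a a em ep := by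
  rw [slyZminus_def, slyZplus_def]
  -- swap the halves termwise
  have h1 : ∑ a ∈ range (n + 1), ∑ b ∈ Ioc a n, slyF n m' k lam a b ep em =
      ∑ a ∈ range (n + 1), ∑ b ∈ Ioc a n, slyF n m' k lam b a em ep := by
    refine sum_congr rfl fun a ha => sum_congr rfl fun b hb => ?_
    rw [mem_range] at ha
    rw [mem_Ioc] at hb
    exact slyF_swap lam (by omega) hb.2 hep hem
  rw [h1]
  -- exchange the order of summation: `{(a, b) : a ≤ n, a < b ≤ n} = {(b, a) : b ≤ n, a < b}`
  have h2 : ∑ a ∈ range (n + 1), ∑ b ∈ Ioc a n, slyF n m' k lam b a em ep =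
      ∑ b ∈ range (n + 1), ∑ a ∈ range b, slyF n m' k lam b a em ep := by
    rw [Finset.sum_sigma', Finset.sum_sigma']
    refine Finset.sum_bij' (fun x _ => ⟨x.2, x.1⟩) (fun x _ => ⟨x.2, x.1⟩) ?_ ?_ ?_ ?_ ?_
    · rintro ⟨a, b⟩ hx
      simp only [Finset.mem_sigma, mem_range, mem_Ioc] at hx ⊢
      omega
    · rintro ⟨b, a⟩ hx
      simp only [Finset.mem_sigma, mem_range, mem_Ioc] at hx ⊢
      omega
    · rintro ⟨a, b⟩ _; rfl
    · rintro ⟨b, a⟩ _; rfl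
    · rintro ⟨a, b⟩ _; rfl
  rw [h2]
  -- split off the diagonal from `Σ_{a < b+1}`... i.e. `range (b+1) = range b ∪ {b}`
  have h3 : ∀ b ∈ range (n + 1), ∑ a ∈ range (b + 1), slyF n m' k lam b a em ep =
      (∑ a ∈ range b, slyF n m' k lam b a em ep) + slyF n m' k lam b b em ep := by
    intro b _
    rw [Finset.sum_range_succ]
  rw [Finset.sum_congr rfl h3, Finset.sum_add_distrib]
  ring

/-- **Window geometry.** For `ρ ≤ min(p⁺/2, u*/4, (p⁺-p⁻)/4)` (`u* = 1-p⁺-p⁻`), a point `(α, β)` of the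
`ρ`-window around `(p⁺, p⁻)` has `α ≥ p⁺/2`, `1 - α - β ≥ u*/2`, `β < α`, and lies at
`ℓ_∞`-distance `> ρ` from `(p⁻, p⁺)`; and no point is in both the window and the diagonal. [folklore] -/
theorem slyWindow_geometry {pp pm ρ α β : ℝ} (hlt : pm < pp)
    (hρ : ρ ≤ min (min (pp / 2) ((1 - pp - pm) / 4)) ((pp - pm) / 4))
    (hα : |α - pp| ≤ ρ) (hβ : |β - pm| ≤ ρ) :
    pp / 2 ≤ α ∧ (1 - pp - pm) / 2 ≤ 1 - α - β ∧ β < α ∧ ρ < max |α - pm| |β - pp| := by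
  have h1 : ρ ≤ pp / 2 := hρ.trans ((min_le_left _ _).trans (min_le_left _ _))
  have h2 : ρ ≤ (1 - pp - pm) / 4 := hρ.trans ((min_le_left _ _).trans (min_le_right _ _))
  have h3 : ρ ≤ (pp - pm) / 4 := hρ.trans (min_le_right _ _)
  rw [abs_le] at hα hβ
  refine ⟨by linarith, by linarith, by linarith, ?_⟩
  have : ρ < |α - pm| := by
    rw [lt_abs]; left; linarith
  exact lt_max_of_lt_left this

/-- **The ratio of the two first moments**, for the named functions:
`slyF/mwwF = λ^{η⁺+η⁻} [C(n+m'-b-η⁻, a+η⁺)/C(n+m', a+η⁺)]^k [C(n,a)/C(n-b,a)]^k` for `a + b ≤ n`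
(the quantity of `sly_lemma31_abs_log_ratio_sub_le`). [cite: Sly2010, Lemma 3.1] -/
theorem slyF_div_mwwF_eq {n m' k a b ep em : ℕ} {lam : ℝ} (hlam : 0 < lam) (hab : a + b ≤ n) :
    slyF n m' k lam a b ep em / mwwF n k lam a b =
      lam ^ (ep + em) * (((n + m' - b - em).choose (a + ep) : ℝ) / ((n + m').choose (a + ep))) ^ k *
        ((n.choose a : ℝ) / ((n - b).choose a)) ^ k := by
  have hCa : (0 : ℝ) < n.choose a := by exact_mod_cast Nat.choose_pos (by omega)
  have hCb : (0 : ℝ) < n.choose b := by exact_mod_cast Nat.choose_pos (by omega)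
  have hCba : (0 : ℝ) < (n - b).choose a := by exact_mod_cast Nat.choose_pos (by omega)
  have hmww : 0 < mwwF n k lam a b := by rw [mwwF_def]; positivity
  have e : ((n.choose a : ℝ) / ((n - b).choose a)) ^ k * (((n - b).choose a : ℝ) / (n.choose a)) ^ (k + 1) =
      ((n - b).choose a : ℝ) / (n.choose a) := by
    rw [pow_succ, ← mul_assoc, ← mul_pow, div_mul_div_comm, mul_comm ((n.choose a : ℝ)),
      div_self (mul_ne_zero hCba.ne' hCa.ne'), one_pow, one_mul]
  rw [div_eq_iff hmww.ne', slyF_def, mwwF_def, show n + m' - (b + em) = n + m' - b - em by omega]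
  calc lam ^ (a + b + ep + em) * (n.choose a) * (n.choose b) *
        (((n + m' - b - em).choose (a + ep) : ℝ) / ((n + m').choose (a + ep))) ^ k *
        (((n - b).choose a : ℝ) / (n.choose a))
      = lam ^ (ep + em) * (((n + m' - b - em).choose (a + ep) : ℝ) / ((n + m').choose (a + ep))) ^ k *
          (lam ^ (a + b) * (n.choose a) * (n.choose b)) *
          (((n.choose a : ℝ) / ((n - b).choose a)) ^ k * (((n - b).choose a : ℝ) / (n.choose a)) ^ (k + 1)) := by
        rw [e]; ring
    _ = _ := by ring

/-- **The main term of Lemma 3.1 in the scaled variables** `α = a/n`, `β = b/n`: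
`(η⁺+η⁻) log λ + k[(m'-η⁻) log((n-b)/(n-b-a)) + η⁺ log((n-b-a)/a) - m' log(n/(n-a)) - η⁺ log((n-a)/a)]`
`= k m' c₁(α,β) + η⁻ c₂(α,β) + η⁺ c₃(α,β)` with `c₁ = log(1-α) + log(1-β) - log(1-α-β)`,
`c₂ = log λ - k(log(1-β) - log(1-α-β))`, `c₃ = log λ + k(log(1-α-β) - log(1-α))` (Sly's regrouping
"`C* (λ(u/(1-β))^{d-1})^{η⁻} (λ(u/(1-α))^{d-1})^{η⁺}`"). [cite: Sly2010, Lemma 3.1 (statement)] -/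
theorem sly_mainTerm_scaled {n a b : ℕ} (mp ep em k : ℕ) (lam : ℝ) (ha : 0 < a) (hab : a + b < n) :
    ((ep : ℝ) + em) * Real.log lam +
        k * (((mp : ℝ) - em) * Real.log (((n : ℝ) - b) / ((n : ℝ) - b - a)) +
          ep * Real.log (((n : ℝ) - b - a) / a) -
          mp * Real.log ((n : ℝ) / ((n : ℝ) - a)) - ep * Real.log (((n : ℝ) - a) / a)) =
      k * mp * (Real.log (1 - (a : ℝ) / n) + Real.log (1 - (b : ℝ) / n) - Real.log (1 - (a : ℝ) / n - (b : ℝ) / n)) +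
        em * (Real.log lam - k * (Real.log (1 - (b : ℝ) / n) - Real.log (1 - (a : ℝ) / n - (b : ℝ) / n))) +
        ep * (Real.log lam + k * (Real.log (1 - (a : ℝ) / n - (b : ℝ) / n) - Real.log (1 - (a : ℝ) / n))) := by
  have hn0 : (0 : ℝ) < n := by exact_mod_cast (show 0 < n by omega)
  have haR : (0 : ℝ) < a := by exact_mod_cast ha
  have habR : (a : ℝ) + b < n := by exact_mod_cast hab
  have hb0 : (0 : ℝ) ≤ b := Nat.cast_nonneg b
  have hu : (0 : ℝ) < (n : ℝ) - a - b := by linarith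
  have h1 : (0 : ℝ) < (n : ℝ) - b := by linarith
  have h2 : (0 : ℝ) < (n : ℝ) - a := by linarith
  -- the scaled quantities
  have su : 1 - (a : ℝ) / n - (b : ℝ) / n = ((n : ℝ) - a - b) / n := by field_simp
  have s1 : 1 - (b : ℝ) / n = ((n : ℝ) - b) / n := by field_simp
  have s2 : 1 - (a : ℝ) / n = ((n : ℝ) - a) / n := by field_simp
  rw [su, s1, s2, Real.log_div h1.ne' hn0.ne', Real.log_div h2.ne' hn0.ne', Real.log_div hu.ne' hn0.ne',
    show (n : ℝ) - b - a = (n : ℝ) - a - b by ring, Real.log_div h1.ne' hu.ne', Real.log_div hu.ne' haR.ne',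
    Real.log_div hn0.ne' h2.ne', Real.log_div h2.ne' haR.ne']
  ring

/-- **The limit coefficients**: at the critical point (`λ u*^{k+1} = p^{±}(1-p^{±})^k`, `u* = 1-p⁺-p⁻`),
`log(p⁻/u*) = log λ - k(log(1-p⁻) - log u*)` and `log(p⁺/u*) = log λ + k(log u* - log(1-p⁺))`
(`slyCritical_portWeight`, logarithmically). [cite: Sly2010, eq. (e:pqRelation2)] -/
theorem sly_limitCoeff_eq {k : ℕ} {lam pp pm : ℝ} (hlam : 0 < lam) (hpm : 0 < pm) (hpp : 0 < pp)
    (hsum : pp + pm < 1)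
    (hEα : lam * (1 - pp - pm) ^ (k + 1) = pp * (1 - pp) ^ k)
    (hEβ : lam * (1 - pp - pm) ^ (k + 1) = pm * (1 - pm) ^ k) :
    Real.log (pm / (1 - pp - pm)) = Real.log lam - k * (Real.log (1 - pm) - Real.log (1 - pp - pm)) ∧
      Real.log (pp / (1 - pp - pm)) = Real.log lam + k * (Real.log (1 - pp - pm) - Real.log (1 - pp)) ∧
      Real.log ((1 - pp) * (1 - pm) / (1 - pp - pm)) =
        Real.log (1 - pp) + Real.log (1 - pm) - Real.log (1 - pp - pm) := by
  have hu0 : 0 < 1 - pp - pm := by linarith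
  obtain ⟨w1, w2, -, -⟩ := slyCritical_portWeight (k := k) hpm hpp hsum hEα hEβ
  refine ⟨?_, ?_, ?_⟩
  · rw [← w1, Real.log_mul hlam.ne' (pow_ne_zero _ (div_pos hu0 (by linarith)).ne'), Real.log_pow,
      Real.log_div hu0.ne' (by linarith : (1 - pm : ℝ) ≠ 0)]
    ring
  · rw [← w2, Real.log_mul hlam.ne' (pow_ne_zero _ (div_pos hu0 (by linarith)).ne'), Real.log_pow,
      Real.log_div hu0.ne' (by linarith : (1 - pp : ℝ) ≠ 0)]
  · rw [Real.log_div (mul_pos (by linarith) (by linarith)).ne' hu0.ne',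
      Real.log_mul (by linarith : (1 - pp : ℝ) ≠ 0) (by linarith : (1 - pm : ℝ) ≠ 0)]

/-- The coefficient combination moves by at most `20 k m' κ` when the three basic logarithms move by
at most `2κ, 2κ, 4κ` (`η^{±} ≤ m'`). [folklore] -/
theorem abs_coeffComb_sub_le {k mp ep em : ℕ} {A1 A2 A3 κ : ℝ} (hep : ep ≤ mp) (hem : em ≤ mp)
    (h1 : |A1| ≤ 2 * κ) (h2 : |A2| ≤ 2 * κ) (h3 : |A3| ≤ 4 * κ) :
    |(k : ℝ) * mp * (A1 + A2 - A3) - em * k * (A2 - A3) + ep * k * (A3 - A1)| ≤ 20 * k * mp * κ := by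
  have hk0 : (0 : ℝ) ≤ k := Nat.cast_nonneg k
  have hmp0 : (0 : ℝ) ≤ mp := Nat.cast_nonneg mp
  have hepR : (ep : ℝ) ≤ mp := by exact_mod_cast hep
  have hemR : (em : ℝ) ≤ mp := by exact_mod_cast hem
  have hκ : 0 ≤ κ := by linarith [abs_nonneg A1]
  have t1 : |(k : ℝ) * mp * (A1 + A2 - A3)| ≤ k * mp * (8 * κ) := by
    rw [abs_mul, abs_of_nonneg (by positivity : (0:ℝ) ≤ k * mp)]
    refine mul_le_mul_of_nonneg_left ?_ (by positivity)
    have := abs_sub (A1 + A2) A3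
    have := abs_add_le A1 A2
    linarith
  have t2 : |(em : ℝ) * k * (A2 - A3)| ≤ mp * k * (6 * κ) := by
    rw [abs_mul, abs_of_nonneg (by positivity : (0:ℝ) ≤ em * k)]
    refine mul_le_mul (mul_le_mul_of_nonneg_right hemR hk0) ?_ (abs_nonneg _) (by positivity)
    have := abs_sub A2 A3
    linarith
  have t3 : |(ep : ℝ) * k * (A3 - A1)| ≤ mp * k * (6 * κ) := by
    rw [abs_mul, abs_of_nonneg (by positivity : (0:ℝ) ≤ ep * k)]
    refine mul_le_mul (mul_le_mul_of_nonneg_right hepR hk0) ?_ (abs_nonneg _) (by positivity)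
    have := abs_sub A3 A1
    linarith
  have s1 := abs_sub ((k : ℝ) * mp * (A1 + A2 - A3)) (em * k * (A2 - A3))
  have s2 := abs_add_le ((k : ℝ) * mp * (A1 + A2 - A3) - em * k * (A2 - A3)) (ep * k * (A3 - A1))
  have e : (k : ℝ) * mp * (8 * κ) + mp * k * (6 * κ) + mp * k * (6 * κ) = 20 * k * mp * κ := by ring
  linarith

/-- **On the dominant window, the ratio of the two first moments is the port weight.** With
`u* = 1-p⁺-p⁻`, `C₀ = (1-p⁺)(1-p⁻)/u*`, for `(a/n, b/n)` within `ρ ≤ u*/4` of the critical point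
`(p⁺, p⁻)` (`λ u*^{k+1} = p^{±}(1-p^{±})^k`), `a ≥ p⁺n/2`, `n - a - b ≥ u* n/2` and
`8m' ≤ min(p⁺, u*) n/2`:
`|log(E Z^{a,b}_{G̃}(η)/E Z^{a,b}_{MWW}) - [k m' log C₀ + η⁻ log(p⁻/u*) + η⁺ log(p⁺/u*)]| ≤ 32 k m'²/(c n) + 20 k m' ρ/u*`,
`c = min(p⁺, u*)/2` — Sly's (e:gtEZ4) `E Z^{α,β}(η) ≈ C* (q⁻/(1-q⁻))^{η⁻} (q⁺/(1-q⁺))^{η⁺} E Z^{α,β}_{MWW}`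
made quantitative (Lemma 3.1 `sly_lemma31_abs_log_ratio_sub_le` + the Lipschitz bounds
`abs_log_sub_log_le_near` + `slyCritical_portWeight`; `q^{±}/(1-q^{±}) = p^{±}/u*`).
[cite: Sly2010, proof of Lemma 3.3 (eqs. (e:gtEZ3), (e:gtEZ4))] -/
theorem abs_log_slyF_div_mwwF_sub_le {n m' k a b ep em : ℕ} {lam pp pm ρ : ℝ} (hlam : 0 < lam)
    (hpm : 0 < pm) (hlt : pm < pp) (hsum : pp + pm < 1)
    (hEα : lam * (1 - pp - pm) ^ (k + 1) = pp * (1 - pp) ^ k)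
    (hEβ : lam * (1 - pp - pm) ^ (k + 1) = pm * (1 - pm) ^ k)
    (hn : 1 ≤ n) (hep : ep ≤ m') (hem : em ≤ m')
    (hρ : ρ ≤ (1 - pp - pm) / 4) (hαρ : |(a : ℝ) / n - pp| ≤ ρ) (hβρ : |(b : ℝ) / n - pm| ≤ ρ)
    (ha : pp / 2 * n ≤ a) (hu : (1 - pp - pm) / 2 * n ≤ (n : ℝ) - a - b)
    (hm : 8 * (m' : ℝ) ≤ min (pp / 2) ((1 - pp - pm) / 2) * n) :
    |Real.log (slyF n m' k lam a b ep em / mwwF n k lam a b) -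
        (k * m' * Real.log ((1 - pp) * (1 - pm) / (1 - pp - pm)) +
          em * Real.log (pm / (1 - pp - pm)) + ep * Real.log (pp / (1 - pp - pm)))| ≤
      32 * k * (m' : ℝ) ^ 2 / (min (pp / 2) ((1 - pp - pm) / 2) * n) +
        20 * k * m' * (ρ / (1 - pp - pm)) := by
  -- positivity bookkeeping
  have hpp : 0 < pp := hpm.trans hlt
  have hu0 : 0 < 1 - pp - pm := by linarith
  have hn0 : (0 : ℝ) < n := by exact_mod_cast hn
  have hc0 : 0 < min (pp / 2) ((1 - pp - pm) / 2) := lt_min (by linarith) (by linarith)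
  have haR : (0 : ℝ) < a := lt_of_lt_of_le (by positivity) ha
  have ha0 : 0 < a := by exact_mod_cast haR
  have huR : (0 : ℝ) < (n : ℝ) - a - b := lt_of_lt_of_le (by positivity) hu
  have hab : a + b < n := by
    have : ((a : ℝ) + b) < n := by linarith
    exact_mod_cast this
  have hmin : min (pp / 2) ((1 - pp - pm) / 2) * n ≤ min (a : ℝ) ((n : ℝ) - a - b) := by
    refine le_min ?_ ?_
    · exact le_trans (mul_le_mul_of_nonneg_right (min_le_left _ _) hn0.le) ha
    · exact le_trans (mul_le_mul_of_nonneg_right (min_le_right _ _) hn0.le) hu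
  have hmin0 : 0 < min (a : ℝ) ((n : ℝ) - a - b) := lt_min haR huR
  have hepR : (ep : ℝ) ≤ m' := by exact_mod_cast hep
  have hemR : (em : ℝ) ≤ m' := by exact_mod_cast hem
  have hep0 : (0 : ℝ) ≤ ep := Nat.cast_nonneg _
  have hem0 : (0 : ℝ) ≤ em := Nat.cast_nonneg _
  -- Lemma 3.1
  have hside1 : 4 * ((m' : ℝ) + em) ≤ min (a : ℝ) ((n : ℝ) - a - b) := by
    linarith only [hmin, hm, hemR]
  have hside2 : 4 * (ep : ℝ) ≤ min (a : ℝ) ((n : ℝ) - a - b) := by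
    linarith only [hmin, hm, hepR, hem0, hemR]
  have h31 := sly_lemma31_abs_log_ratio_sub_le n m' a b ep em k hlam ha0 hab hem hside1 hside2
  rw [← slyF_div_mwwF_eq hlam hab.le, sly_mainTerm_scaled m' ep em k lam ha0 hab] at h31
  -- the error term of Lemma 3.1 is at most `32 k m'²/(c n)`
  have hk0 : (0 : ℝ) ≤ k := Nat.cast_nonneg k
  have herr : 8 * k * ((((m' : ℝ) - em) ^ 2 + (ep : ℝ) ^ 2) + ((m' : ℝ) ^ 2 + (ep : ℝ) ^ 2)) /
      min (a : ℝ) ((n : ℝ) - a - b) ≤ 32 * k * (m' : ℝ) ^ 2 / (min (pp / 2) ((1 - pp - pm) / 2) * n) := by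
    have h1 : ((m' : ℝ) - em) ^ 2 ≤ (m' : ℝ) ^ 2 := by nlinarith only [hemR, hem0]
    have h2 : (ep : ℝ) ^ 2 ≤ (m' : ℝ) ^ 2 := pow_le_pow_left₀ hep0 hepR 2
    have h3 : (((m' : ℝ) - em) ^ 2 + (ep : ℝ) ^ 2) + ((m' : ℝ) ^ 2 + (ep : ℝ) ^ 2) ≤ 4 * (m' : ℝ) ^ 2 := by
      linarith only [h1, h2]
    have hnum : 8 * k * ((((m' : ℝ) - em) ^ 2 + (ep : ℝ) ^ 2) + ((m' : ℝ) ^ 2 + (ep : ℝ) ^ 2)) ≤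
        32 * k * (m' : ℝ) ^ 2 := by
      have := mul_le_mul_of_nonneg_left h3 (by positivity : (0 : ℝ) ≤ 8 * k)
      linarith only [this]
    calc _ ≤ 32 * k * (m' : ℝ) ^ 2 / min (a : ℝ) ((n : ℝ) - a - b) :=
          div_le_div_of_nonneg_right hnum hmin0.le
      _ ≤ _ := div_le_div_of_nonneg_left (by positivity) (mul_pos hc0 hn0) hmin
  -- the limit coefficients and the three Lipschitz estimates
  obtain ⟨hl1, hl2, hl0⟩ := sly_limitCoeff_eq hlam hpm hpp hsum hEα hEβ
  obtain ⟨L1, L2, L3⟩ := abs_log_sub_log_le_near hpp.le hpm.le hu0 (hαρ.trans hρ) (hβρ.trans hρ)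
  have hmaxρ : max |(a : ℝ) / n - pp| |(b : ℝ) / n - pm| ≤ ρ := max_le hαρ hβρ
  set κ : ℝ := ρ / (1 - pp - pm) with hκ
  have hA1 : |Real.log (1 - (a : ℝ) / n) - Real.log (1 - pp)| ≤ 2 * κ := by
    refine L1.trans ?_
    rw [hκ, show 2 * (ρ / (1 - pp - pm)) = 2 / (1 - pp - pm) * ρ by ring]
    exact mul_le_mul_of_nonneg_left hmaxρ (by positivity)
  have hA2 : |Real.log (1 - (b : ℝ) / n) - Real.log (1 - pm)| ≤ 2 * κ := by
    refine L2.trans ?_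
    rw [hκ, show 2 * (ρ / (1 - pp - pm)) = 2 / (1 - pp - pm) * ρ by ring]
    exact mul_le_mul_of_nonneg_left hmaxρ (by positivity)
  have hA3 : |Real.log (1 - (a : ℝ) / n - (b : ℝ) / n) - Real.log (1 - pp - pm)| ≤ 4 * κ := by
    refine L3.trans ?_
    rw [hκ, show 4 * (ρ / (1 - pp - pm)) = 4 / (1 - pp - pm) * ρ by ring]
    exact mul_le_mul_of_nonneg_left hmaxρ (by positivity)
  have hT := abs_coeffComb_sub_le (k := k) hep hem hA1 hA2 hA3
  -- main term minus its limit is the coefficient combination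
  have hdiff : (k : ℝ) * m' * (Real.log (1 - (a : ℝ) / n) + Real.log (1 - (b : ℝ) / n) -
        Real.log (1 - (a : ℝ) / n - (b : ℝ) / n)) +
      em * (Real.log lam - k * (Real.log (1 - (b : ℝ) / n) - Real.log (1 - (a : ℝ) / n - (b : ℝ) / n))) +
      ep * (Real.log lam + k * (Real.log (1 - (a : ℝ) / n - (b : ℝ) / n) - Real.log (1 - (a : ℝ) / n))) -
      (k * m' * Real.log ((1 - pp) * (1 - pm) / (1 - pp - pm)) +
        em * Real.log (pm / (1 - pp - pm)) + ep * Real.log (pp / (1 - pp - pm))) =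
      (k : ℝ) * m' * ((Real.log (1 - (a : ℝ) / n) - Real.log (1 - pp)) +
          (Real.log (1 - (b : ℝ) / n) - Real.log (1 - pm)) -
          (Real.log (1 - (a : ℝ) / n - (b : ℝ) / n) - Real.log (1 - pp - pm))) -
        em * k * ((Real.log (1 - (b : ℝ) / n) - Real.log (1 - pm)) -
          (Real.log (1 - (a : ℝ) / n - (b : ℝ) / n) - Real.log (1 - pp - pm))) +
        ep * k * ((Real.log (1 - (a : ℝ) / n - (b : ℝ) / n) - Real.log (1 - pp - pm)) -
          (Real.log (1 - (a : ℝ) / n) - Real.log (1 - pp))) := by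
    rw [hl0, hl1, hl2]; ring
  -- combine
  have key := abs_sub_le (Real.log (slyF n m' k lam a b ep em / mwwF n k lam a b))
    ((k : ℝ) * m' * (Real.log (1 - (a : ℝ) / n) + Real.log (1 - (b : ℝ) / n) -
        Real.log (1 - (a : ℝ) / n - (b : ℝ) / n)) +
      em * (Real.log lam - k * (Real.log (1 - (b : ℝ) / n) - Real.log (1 - (a : ℝ) / n - (b : ℝ) / n))) +
      ep * (Real.log lam + k * (Real.log (1 - (a : ℝ) / n - (b : ℝ) / n) - Real.log (1 - (a : ℝ) / n))))
    (k * m' * Real.log ((1 - pp) * (1 - pm) / (1 - pp - pm)) +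
        em * Real.log (pm / (1 - pp - pm)) + ep * Real.log (pp / (1 - pp - pm)))
  rw [hdiff] at key
  linarith only [key, h31, herr, hT]

/-- **Upper bound for `E Z^{a,b}_{G̃}(η)` everywhere**:
`slyF ≤ exp(n Φ₁(a/n,b/n) + (k+3)((log n)/2 + 1) + (η⁺+η⁻) log λ + k m' log(n+m'))` for `a + b ≤ n`
(`slyFirstMoment_le_mul_mww` and `abs_log_mwwFirstMoment_sub_le`). [cite: Sly2010, proof of Lemma 3.3] -/
theorem slyF_le_exp {n m' k a b ep em : ℕ} {lam : ℝ} (hlam : 0 < lam) (hn : 1 ≤ n) (hab : a + b ≤ n) :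
    slyF n m' k lam a b ep em ≤
      Real.exp (n * slyPhi1 (k + 1) lam (a / n) (b / n) + ((k : ℝ) + 3) * (Real.log n / 2 + 1) +
        ((ep : ℝ) + em) * Real.log lam + k * m' * Real.log ((n : ℝ) + m')) := by
  have hCa : (0 : ℝ) < n.choose a := by exact_mod_cast Nat.choose_pos (by omega)
  have hCb : (0 : ℝ) < n.choose b := by exact_mod_cast Nat.choose_pos (by omega)
  have hCba : (0 : ℝ) < (n - b).choose a := by exact_mod_cast Nat.choose_pos (by omega)
  have hmww : 0 < mwwF n k lam a b := by rw [mwwF_def]; positivity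
  have h1 : slyF n m' k lam a b ep em ≤ lam ^ (ep + em) * ((n : ℝ) + m') ^ (k * m') * mwwF n k lam a b := by
    rw [slyF_def, mwwF_def]; exact slyFirstMoment_le_mul_mww hlam hab
  have h2 := abs_log_mwwFirstMoment_sub_le (n := n) (a := a) (b := b) (k + 1) hlam hn hab
  rw [← mwwF_def, abs_le] at h2
  have hnm : (0 : ℝ) < (n : ℝ) + m' := by positivity
  have h3 : mwwF n k lam a b ≤ Real.exp (n * slyPhi1 (k + 1) lam (a / n) (b / n) +
      ((k : ℝ) + 3) * (Real.log n / 2 + 1)) := by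
    rw [← Real.exp_log hmww]
    apply Real.exp_le_exp.2
    push_cast at h2
    linarith [h2.2]
  calc slyF n m' k lam a b ep em ≤ lam ^ (ep + em) * ((n : ℝ) + m') ^ (k * m') * mwwF n k lam a b := h1
    _ ≤ lam ^ (ep + em) * ((n : ℝ) + m') ^ (k * m') * Real.exp (n * slyPhi1 (k + 1) lam (a / n) (b / n) +
        ((k : ℝ) + 3) * (Real.log n / 2 + 1)) := mul_le_mul_of_nonneg_left h3 (by positivity)
    _ = _ := by
        have e1 : lam ^ (ep + em) = Real.exp (((ep : ℝ) + em) * Real.log lam) := by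
          rw [← Real.exp_log (pow_pos hlam (ep + em)), Real.log_pow]; push_cast; ring_nf
        have e2 : ((n : ℝ) + m') ^ (k * m') = Real.exp ((k : ℝ) * m' * Real.log ((n : ℝ) + m')) := by
          rw [← Real.exp_log (pow_pos hnm (k * m')), Real.log_pow]; push_cast; ring_nf
        rw [e1, e2, ← Real.exp_add, ← Real.exp_add]
        congr 1
        ring

/-- **Lower bound for `E Z^{a,b}_{MWW}`**: `exp(n Φ₁(a/n,b/n) - (k+3)((log n)/2 + 1)) ≤ mwwF` for
`a + b ≤ n` (`abs_log_mwwFirstMoment_sub_le`). [cite: Sly2010, proof of Lemma 3.3] -/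
theorem exp_le_mwwF {n k a b : ℕ} {lam : ℝ} (hlam : 0 < lam) (hn : 1 ≤ n) (hab : a + b ≤ n) :
    Real.exp (n * slyPhi1 (k + 1) lam (a / n) (b / n) - ((k : ℝ) + 3) * (Real.log n / 2 + 1)) ≤
      mwwF n k lam a b := by
  have hCa : (0 : ℝ) < n.choose a := by exact_mod_cast Nat.choose_pos (by omega)
  have hCb : (0 : ℝ) < n.choose b := by exact_mod_cast Nat.choose_pos (by omega)
  have hCba : (0 : ℝ) < (n - b).choose a := by exact_mod_cast Nat.choose_pos (by omega)
  have hmww : 0 < mwwF n k lam a b := by rw [mwwF_def]; positivity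
  have h2 := abs_log_mwwFirstMoment_sub_le (n := n) (a := a) (b := b) (k + 1) hlam hn hab
  rw [← mwwF_def, abs_le] at h2
  rw [← Real.exp_log hmww]
  apply Real.exp_le_exp.2
  push_cast at h2
  linarith [h2.1]

/-- **Upper bound for `E Z^{a,b}_{MWW}`**: `mwwF ≤ exp(n Φ₁(a/n,b/n) + (k+3)((log n)/2 + 1))` for
`a + b ≤ n` (`abs_log_mwwFirstMoment_sub_le`). [cite: Sly2010, proof of Lemma 3.3] -/
theorem mwwF_le_exp {n k a b : ℕ} {lam : ℝ} (hlam : 0 < lam) (hn : 1 ≤ n) (hab : a + b ≤ n) :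
    mwwF n k lam a b ≤
      Real.exp (n * slyPhi1 (k + 1) lam (a / n) (b / n) + ((k : ℝ) + 3) * (Real.log n / 2 + 1)) := by
  have hCa : (0 : ℝ) < n.choose a := by exact_mod_cast Nat.choose_pos (by omega)
  have hCb : (0 : ℝ) < n.choose b := by exact_mod_cast Nat.choose_pos (by omega)
  have hCba : (0 : ℝ) < (n - b).choose a := by exact_mod_cast Nat.choose_pos (by omega)
  have hmww : 0 < mwwF n k lam a b := by rw [mwwF_def]; positivity
  have h2 := abs_log_mwwFirstMoment_sub_le (n := n) (a := a) (b := b) (k + 1) hlam hn hab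
  rw [← mwwF_def, abs_le] at h2
  rw [← Real.exp_log hmww]
  apply Real.exp_le_exp.2
  push_cast at h2
  linarith [h2.2]

/-- **Lower bound for `E Z^{a,b}_{G̃}(η)` on the window**: under the hypotheses of
`abs_log_slyF_div_mwwF_sub_le`,
`exp(n Φ₁(a/n,b/n) - (k+3)((log n)/2+1) + G₀(η) - τ) ≤ slyF` with `G₀(η) = k m' log C₀ + η⁻ log(p⁻/u*) + η⁺ log(p⁺/u*)`
and `τ` the error of that lemma. [cite: Sly2010, proof of Lemma 3.3 (eq. (e:gtEZ4))] -/
theorem exp_le_slyF_window {n m' k a b ep em : ℕ} {lam pp pm ρ : ℝ} (hlam : 0 < lam)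
    (hpm : 0 < pm) (hlt : pm < pp) (hsum : pp + pm < 1)
    (hEα : lam * (1 - pp - pm) ^ (k + 1) = pp * (1 - pp) ^ k)
    (hEβ : lam * (1 - pp - pm) ^ (k + 1) = pm * (1 - pm) ^ k)
    (hn : 1 ≤ n) (hep : ep ≤ m') (hem : em ≤ m')
    (hρ : ρ ≤ (1 - pp - pm) / 4) (hαρ : |(a : ℝ) / n - pp| ≤ ρ) (hβρ : |(b : ℝ) / n - pm| ≤ ρ)
    (ha : pp / 2 * n ≤ a) (hu : (1 - pp - pm) / 2 * n ≤ (n : ℝ) - a - b)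
    (hm : 8 * (m' : ℝ) ≤ min (pp / 2) ((1 - pp - pm) / 2) * n) :
    Real.exp (n * slyPhi1 (k + 1) lam (a / n) (b / n) - ((k : ℝ) + 3) * (Real.log n / 2 + 1) +
        (k * m' * Real.log ((1 - pp) * (1 - pm) / (1 - pp - pm)) +
          em * Real.log (pm / (1 - pp - pm)) + ep * Real.log (pp / (1 - pp - pm))) -
        (32 * k * (m' : ℝ) ^ 2 / (min (pp / 2) ((1 - pp - pm) / 2) * n) +
          20 * k * m' * (ρ / (1 - pp - pm)))) ≤ slyF n m' k lam a b ep em := by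
  have hpp : 0 < pp := hpm.trans hlt
  have hu0 : 0 < 1 - pp - pm := by linarith
  have hn0 : (0 : ℝ) < n := by exact_mod_cast hn
  have haR : (0 : ℝ) < a := lt_of_lt_of_le (by positivity) ha
  have huR : (0 : ℝ) < (n : ℝ) - a - b := lt_of_lt_of_le (mul_pos (by linarith) hn0) hu
  have hab : a + b < n := by
    have : ((a : ℝ) + b) < n := by linarith
    exact_mod_cast this
  -- `slyF > 0` on the window: `a + η⁺ + b + η⁻ ≤ n + m'`
  have hmR : (m' : ℝ) ≤ (1 - pp - pm) / 2 * n := by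
    have := min_le_right (pp / 2) ((1 - pp - pm) / 2)
    nlinarith [mul_le_mul_of_nonneg_right this hn0.le]
  have hroom : a + ep + (b + em) ≤ n + m' := by
    have h1 : ((a : ℝ) + b) + m' ≤ n := by linarith
    have h2 : a + b + m' ≤ n := by exact_mod_cast h1
    omega
  have hCa : (0 : ℝ) < n.choose a := by exact_mod_cast Nat.choose_pos (by omega)
  have hCb : (0 : ℝ) < n.choose b := by exact_mod_cast Nat.choose_pos (by omega)
  have hCba : (0 : ℝ) < (n - b).choose a := by exact_mod_cast Nat.choose_pos (by omega)
  have hCN : (0 : ℝ) < (n + m').choose (a + ep) := by exact_mod_cast Nat.choose_pos (by omega)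
  have hCNB : (0 : ℝ) < (n + m' - (b + em)).choose (a + ep) := by
    exact_mod_cast Nat.choose_pos (by omega)
  have hsly : 0 < slyF n m' k lam a b ep em := by rw [slyF_def]; positivity
  have hmww : 0 < mwwF n k lam a b := by rw [mwwF_def]; positivity
  have hC := abs_log_slyF_div_mwwF_sub_le hlam hpm hlt hsum hEα hEβ hn hep hem hρ hαρ hβρ ha hu hm
  rw [Real.log_div hsly.ne' hmww.ne', abs_le] at hC
  have hL := exp_le_mwwF (k := k) hlam hn hab.le
  rw [← Real.exp_log hmww] at hL
  have hL' := Real.exp_le_exp.1 hL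
  rw [← Real.exp_log hsly]
  apply Real.exp_le_exp.2
  linarith [hC.1]
set_option maxHeartbeats 400000 in -- buildfix (bf3-g26): 160k/180k FAIL, 200k PASS at accept time; line-neutral budget line
/-- **Off the windows, every term is negligible against the anchor term** — uniformly in the boundary
configuration. For `d ≥ 3`, `λ > λ_c(𝕋_d)` and the critical point `(p⁺,p⁻)` there is `ℓ ≥ 1` such that,
with `γ = 1/(5ℓ)`, for every `ε > 0` and all large `n`: for all `m' ≤ n^γ`, `η^{±} ≤ m'` and every
`(a, b)`, `a + b ≤ n`, at `ℓ_∞`-distance `> n^{-1/(2ℓ)}` from both `(p^{±}, p^{∓})`,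
`E Z^{a,b}_{G̃}(η) ≤ ε (n+1)^{-2} E Z^{⌊p⁺n⌋,⌊p⁻n⌋}_{G̃}(η)` and likewise for `E Z^{a,b}_{MWW}` — the
termwise form of Sly's (e:gtEZ2) (and of its `η`-free analogue for `Z_{MWW}`), from `slyPhi1_offWindow`,
the upper bound `slyF_le_exp`, and the lower bound at the anchor `exp_le_slyF_window` (the
`η`-dependent factor `exp(G₀(η))` cancels; all the `O(m' log n)` slack is `o(√n)` for `m' ≤ n^γ`,
`γ < 1/2`). [cite: Sly2010, proof of Lemma 3.3 (eq. (e:gtEZ2), "Setting `θ* = ψ* = 1/(5ℓ)`")] -/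
theorem sly_offWindow_pointwise {d : ℕ} (hd : 3 ≤ d) {lam pp pm : ℝ} (hlam : hardCoreThreshold d < lam)
    (hpm : 0 < pm) (hlt : pm < pp) (hsum : pp + pm < 1)
    (hEα : lam * (1 - pp - pm) ^ d = pp * (1 - pp) ^ (d - 1))
    (hEβ : lam * (1 - pp - pm) ^ d = pm * (1 - pm) ^ (d - 1)) :
    ∃ ℓ : ℕ, 1 ≤ ℓ ∧ ∀ ε : ℝ, 0 < ε → ∃ n₀ : ℕ, ∀ n : ℕ, n₀ ≤ n →
      ∀ m' : ℕ, (m' : ℝ) ≤ (n : ℝ) ^ (1 / (5 * (ℓ : ℝ))) → ∀ ep em : ℕ, ep ≤ m' → em ≤ m' →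
      ∀ a b : ℕ, a + b ≤ n →
        (n : ℝ) ^ (-(1 / (2 * (ℓ : ℝ)))) < max |(a : ℝ) / n - pp| |(b : ℝ) / n - pm| →
        (n : ℝ) ^ (-(1 / (2 * (ℓ : ℝ)))) < max |(a : ℝ) / n - pm| |(b : ℝ) / n - pp| →
          slyF n m' (d - 1) lam a b ep em ≤
              ε / ((n : ℝ) + 1) ^ 2 * slyF n m' (d - 1) lam ⌊pp * n⌋₊ ⌊pm * n⌋₊ ep em ∧
          mwwF n (d - 1) lam a b ≤ ε / ((n : ℝ) + 1) ^ 2 * mwwF n (d - 1) lam ⌊pp * n⌋₊ ⌊pm * n⌋₊ := by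
  obtain ⟨k, rfl⟩ : ∃ k, d = k + 1 := ⟨d - 1, by omega⟩
  simp only [Nat.add_sub_cancel] at hEα hEβ ⊢
  have hlam0 : 0 < lam := (hardCoreThreshold_pos hd).trans hlam
  have hpp : 0 < pp := hpm.trans hlt
  set u : ℝ := 1 - pp - pm with hu
  have hu0 : 0 < u := by rw [hu]; linarith
  set c : ℝ := min (pp / 2) (u / 2) with hc
  have hc0 : 0 < c := lt_min (by linarith) (by linarith)
  -- the constant absorbing all the `O(m' log n)` slack
  set K : ℝ := 3 * ((k : ℝ) + 3) + 2 * |Real.log lam| + 2 * k + k * |Real.log ((1 - pp) * (1 - pm) / u)| +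
    |Real.log (pm / u)| + |Real.log (pp / u)| + 32 * k / c + 20 * k / u + 1 with hK
  have hK0 : 0 < K := by rw [hK]; positivity
  obtain ⟨ℓ, hℓ, hoff⟩ := slyPhi1_offWindow hd hlam hpm hlt hsum hEα hEβ
  have hℓR : (1 : ℝ) ≤ ℓ := by exact_mod_cast hℓ
  refine ⟨ℓ, hℓ, fun ε hε => ?_⟩
  set γ : ℝ := 1 / (5 * (ℓ : ℝ)) with hγ
  have hγ0 : 0 < γ := by positivity
  have hγ5 : γ ≤ 1 / 5 := by
    rw [hγ]; apply div_le_div_of_nonneg_left zero_le_one (by norm_num); linarith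
  obtain ⟨n₀, hn₀⟩ := hoff K γ ε (by linarith) hε
  -- largeness: `n ≥ n₀`, `n ≥ 3`, `1/n ≤ u/4`, `2/pp ≤ n`, `8 n^γ ≤ c n`
  have ev1 : ∀ᶠ n : ℕ in atTop, (1 : ℝ) / n ≤ u / 4 :=
    tendsto_one_div_atTop_nhds_zero_nat.eventually (eventually_le_nhds (by positivity))
  have ev2 : ∀ᶠ n : ℕ in atTop, 2 / pp ≤ (n : ℝ) :=
    tendsto_natCast_atTop_atTop.eventually (eventually_ge_atTop _)
  have ev3 : ∀ᶠ n : ℕ in atTop, 8 * (n : ℝ) ^ γ ≤ c * n := by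
    -- `n^γ / n = n^{γ-1} → 0`
    have h : Tendsto (fun n : ℕ => (n : ℝ) ^ (γ - 1)) atTop (𝓝 0) := by
      have := (tendsto_rpow_neg_atTop (by linarith : (0 : ℝ) < 1 - γ)).comp tendsto_natCast_atTop_atTop
      refine this.congr fun n => ?_
      simp only [Function.comp, neg_sub]
    have h2 := h.eventually (eventually_le_nhds (by positivity : (0 : ℝ) < c / 8))
    filter_upwards [h2, eventually_ge_atTop 1] with n hn hn1
    have hn0 : (0 : ℝ) < n := by exact_mod_cast hn1
    have e : (n : ℝ) ^ γ = (n : ℝ) ^ (γ - 1) * n := by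
      rw [Real.rpow_sub_one hn0.ne']; field_simp
    rw [e]; nlinarith
  obtain ⟨n₁, hn₁⟩ := eventually_atTop.1 (ev1.and (ev2.and (ev3.and (eventually_ge_atTop (max n₀ 3)))))
  refine ⟨n₁, fun n hn m' hm' ep em hep hem a b hab hoff1 hoff2 => ?_⟩
  obtain ⟨h1, h2, h3, h4⟩ := hn₁ n hn
  have hnn₀ : n₀ ≤ n := le_trans (le_max_left _ _) h4
  have hn3 : 3 ≤ n := le_trans (le_max_right _ _) h4
  have hn1 : 1 ≤ n := by omega
  have hnR : (1 : ℝ) ≤ n := by exact_mod_cast hn1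
  have hn0 : (0 : ℝ) < n := by linarith
  have hn3R : (3 : ℝ) ≤ n := by exact_mod_cast hn3
  -- the off-window comparison of exponents
  have hmain := hn₀ n hnn₀ a b hab hoff1 hoff2
  -- elementary size facts: `1 ≤ log n`, `1 ≤ n^γ ≤ n`, `m'² ≤ n`, `log(n+m') ≤ 2 log n`
  have hlog1 : 1 ≤ Real.log n := by
    rw [← Real.log_exp 1]
    exact Real.log_le_log (Real.exp_pos 1) (le_trans (by have := Real.exp_one_lt_d9; norm_num at this; linarith) hn3R)
  have hγ1 : 1 ≤ (n : ℝ) ^ γ := Real.one_le_rpow hnR hγ0.le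
  have hγn : (n : ℝ) ^ γ ≤ n := by
    conv_rhs => rw [← Real.rpow_one (n : ℝ)]
    exact Real.rpow_le_rpow_of_exponent_le hnR (by linarith)
  have hm0 : (0 : ℝ) ≤ m' := Nat.cast_nonneg _
  have hmn : (m' : ℝ) ≤ n := hm'.trans hγn
  have hm2 : (m' : ℝ) ^ 2 ≤ n := by
    have h1' : (m' : ℝ) ^ 2 ≤ ((n : ℝ) ^ γ) ^ 2 := pow_le_pow_left₀ hm0 hm' 2
    have h2' : ((n : ℝ) ^ γ) ^ 2 = (n : ℝ) ^ (2 * γ) := by rw [← Real.rpow_natCast, ← Real.rpow_mul hn0.le]; ring_nf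
    have h3' : (n : ℝ) ^ (2 * γ) ≤ n := by
      conv_rhs => rw [← Real.rpow_one (n : ℝ)]
      exact Real.rpow_le_rpow_of_exponent_le hnR (by linarith)
    linarith [h1', h3']
  have hlog2n : Real.log ((n : ℝ) + m') ≤ 2 * Real.log n := by
    have hle : (n : ℝ) + m' ≤ n * n := by nlinarith only [hmn, hn3R]
    calc Real.log ((n : ℝ) + m') ≤ Real.log (n * n) := Real.log_le_log (by positivity) hle
      _ = 2 * Real.log n := by rw [Real.log_mul hn0.ne' hn0.ne']; ring
  have hepR : (ep : ℝ) ≤ m' := by exact_mod_cast hep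
  have hemR : (em : ℝ) ≤ m' := by exact_mod_cast hem
  have hep0 : (0 : ℝ) ≤ ep := Nat.cast_nonneg _
  have hem0 : (0 : ℝ) ≤ em := Nat.cast_nonneg _
  have hk0 : (0 : ℝ) ≤ k := Nat.cast_nonneg _
  -- the anchor satisfies the window hypotheses with `ρ = 1/n`
  have haρ := abs_floor_div_sub_le hpp.le hn1
  have hbρ := abs_floor_div_sub_le hpm.le hn1
  have hfa : (⌊pp * n⌋₊ : ℝ) ≤ pp * n := Nat.floor_le (by positivity)
  have hfa' : pp * n < (⌊pp * n⌋₊ : ℝ) + 1 := Nat.lt_floor_add_one _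
  have hfb : (⌊pm * n⌋₊ : ℝ) ≤ pm * n := Nat.floor_le (by positivity)
  have hA1 : pp / 2 * n ≤ (⌊pp * n⌋₊ : ℝ) := by
    have h2' : (2 : ℝ) ≤ pp * n := by rw [div_le_iff₀ hpp] at h2; linarith only [h2]
    linarith only [h2', hfa']
  have hun : u * n = n - pp * n - pm * n := by rw [hu]; ring
  have hA2 : (1 - pp - pm) / 2 * n ≤ (n : ℝ) - ⌊pp * n⌋₊ - ⌊pm * n⌋₊ := by
    rw [← hu]; linarith only [hun, hfa, hfb, mul_pos hu0 hn0]
  have hA3 : 8 * (m' : ℝ) ≤ min (pp / 2) ((1 - pp - pm) / 2) * n := by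
    rw [← hu, ← hc]; linarith only [hm', h3]
  have hAsum : ⌊pp * n⌋₊ + ⌊pm * n⌋₊ ≤ n := by
    have : (⌊pp * n⌋₊ : ℝ) + ⌊pm * n⌋₊ ≤ n := by linarith only [hun, hfa, hfb, mul_pos hu0 hn0]
    exact_mod_cast this
  have hlow := exp_le_slyF_window (k := k) hlam0 hpm hlt hsum hEα hEβ hn1 hep hem h1 haρ hbρ hA1 hA2 hA3
  have hup := slyF_le_exp (m' := m') (k := k) (ep := ep) (em := em) hlam0 hn1 hab
  -- the slack is at most `K n^γ log n`
  have hτ : 32 * k * (m' : ℝ) ^ 2 / (min (pp / 2) ((1 - pp - pm) / 2) * n) +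
      20 * k * m' * (1 / n / (1 - pp - pm)) ≤ 32 * k / c + 20 * k / u := by
    rw [← hu, ← hc]
    have t1 : 32 * k * (m' : ℝ) ^ 2 / (c * n) ≤ 32 * k / c := by
      rw [div_le_div_iff₀ (by positivity) hc0]
      have := mul_le_mul_of_nonneg_left hm2 (by positivity : (0:ℝ) ≤ 32 * k * c)
      linarith only [this]
    have t2 : 20 * k * m' * (1 / n / u) ≤ 20 * k / u := by
      rw [div_div, mul_one_div, div_le_div_iff₀ (by positivity) hu0]
      have := mul_le_mul_of_nonneg_left hmn (by positivity : (0:ℝ) ≤ 20 * k * u)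
      linarith only [this]
    linarith only [t1, t2]
  have hG : -(k * m' * Real.log ((1 - pp) * (1 - pm) / (1 - pp - pm)) +
      em * Real.log (pm / (1 - pp - pm)) + ep * Real.log (pp / (1 - pp - pm))) ≤
      (n : ℝ) ^ γ * (k * |Real.log ((1 - pp) * (1 - pm) / u)| + |Real.log (pm / u)| + |Real.log (pp / u)|) := by
    rw [← hu]
    have g1 : -(k * m' * Real.log ((1 - pp) * (1 - pm) / u)) ≤ (n : ℝ) ^ γ * (k * |Real.log ((1 - pp) * (1 - pm) / u)|) := by
      have a1 := neg_le_abs ((k : ℝ) * m' * Real.log ((1 - pp) * (1 - pm) / u))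
      have a2 : |(k : ℝ) * m' * Real.log ((1 - pp) * (1 - pm) / u)| = k * m' * |Real.log ((1 - pp) * (1 - pm) / u)| := by
        rw [abs_mul, abs_of_nonneg (by positivity : (0:ℝ) ≤ k * m')]
      have a3 : (k : ℝ) * m' * |Real.log ((1 - pp) * (1 - pm) / u)| ≤ k * (n : ℝ) ^ γ * |Real.log ((1 - pp) * (1 - pm) / u)| :=
        mul_le_mul_of_nonneg_right (mul_le_mul_of_nonneg_left hm' hk0) (abs_nonneg _)
      linarith only [a1, a2, a3]
    have g2 : -(em * Real.log (pm / u)) ≤ (n : ℝ) ^ γ * |Real.log (pm / u)| := by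
      have a1 := neg_le_abs ((em : ℝ) * Real.log (pm / u))
      have a2 : |(em : ℝ) * Real.log (pm / u)| = em * |Real.log (pm / u)| := by
        rw [abs_mul, abs_of_nonneg hem0]
      have a3 : (em : ℝ) * |Real.log (pm / u)| ≤ (n : ℝ) ^ γ * |Real.log (pm / u)| :=
        mul_le_mul_of_nonneg_right (hemR.trans hm') (abs_nonneg _)
      linarith only [a1, a2, a3]
    have g3 : -(ep * Real.log (pp / u)) ≤ (n : ℝ) ^ γ * |Real.log (pp / u)| := by
      have a1 := neg_le_abs ((ep : ℝ) * Real.log (pp / u))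
      have a2 : |(ep : ℝ) * Real.log (pp / u)| = ep * |Real.log (pp / u)| := by
        rw [abs_mul, abs_of_nonneg hep0]
      have a3 : (ep : ℝ) * |Real.log (pp / u)| ≤ (n : ℝ) ^ γ * |Real.log (pp / u)| :=
        mul_le_mul_of_nonneg_right (hepR.trans hm') (abs_nonneg _)
      linarith only [a1, a2, a3]
    linarith only [g1, g2, g3]
  have hslack : ((k : ℝ) + 3) * (Real.log n / 2 + 1) + ((ep : ℝ) + em) * Real.log lam +
        k * m' * Real.log ((n : ℝ) + m') + ((k : ℝ) + 3) * (Real.log n / 2 + 1) +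
      -(k * m' * Real.log ((1 - pp) * (1 - pm) / (1 - pp - pm)) +
          em * Real.log (pm / (1 - pp - pm)) + ep * Real.log (pp / (1 - pp - pm))) +
      (32 * k * (m' : ℝ) ^ 2 / (min (pp / 2) ((1 - pp - pm) / 2) * n) +
        20 * k * m' * (1 / n / (1 - pp - pm))) ≤ K * ((n : ℝ) ^ γ * Real.log n) := by
    have hX1 : Real.log n ≤ (n : ℝ) ^ γ * Real.log n := le_mul_of_one_le_left (by linarith) hγ1
    have hX2 : (n : ℝ) ^ γ ≤ (n : ℝ) ^ γ * Real.log n := le_mul_of_one_le_right (by positivity) hlog1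
    have hX3 : 1 ≤ (n : ℝ) ^ γ * Real.log n := hγ1.trans hX2
    have s1 : ((k : ℝ) + 3) * (Real.log n / 2 + 1) + ((k : ℝ) + 3) * (Real.log n / 2 + 1) ≤
        3 * ((k : ℝ) + 3) * ((n : ℝ) ^ γ * Real.log n) := by
      have a1 := mul_le_mul_of_nonneg_left hX1 (by positivity : (0:ℝ) ≤ (k:ℝ) + 3)
      have a2 := mul_le_mul_of_nonneg_left hX3 (by positivity : (0:ℝ) ≤ (k:ℝ) + 3)
      linarith only [a1, a2]
    have s2 : ((ep : ℝ) + em) * Real.log lam ≤ 2 * |Real.log lam| * ((n : ℝ) ^ γ * Real.log n) := by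
      have hL0 := abs_nonneg (Real.log lam)
      have t1 : ((ep : ℝ) + em) * Real.log lam ≤ ((ep : ℝ) + em) * |Real.log lam| :=
        mul_le_mul_of_nonneg_left (le_abs_self _) (by positivity)
      have t2 : ((ep : ℝ) + em) * |Real.log lam| ≤ (2 * (n : ℝ) ^ γ) * |Real.log lam| :=
        mul_le_mul_of_nonneg_right (by linarith) hL0
      have t3 : (2 * (n : ℝ) ^ γ) * |Real.log lam| ≤ 2 * |Real.log lam| * ((n : ℝ) ^ γ * Real.log n) := by
        have := mul_le_mul_of_nonneg_left hX2 (by positivity : (0:ℝ) ≤ 2 * |Real.log lam|)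
        linarith only [this]
      linarith only [t1, t2, t3]
    have s3 : (k : ℝ) * m' * Real.log ((n : ℝ) + m') ≤ 2 * k * ((n : ℝ) ^ γ * Real.log n) := by
      have a1 := mul_le_mul hm' hlog2n (Real.log_nonneg (by linarith)) (by positivity)
      have a2 := mul_le_mul_of_nonneg_left a1 hk0
      linarith only [a2]
    have s4 : (n : ℝ) ^ γ * (k * |Real.log ((1 - pp) * (1 - pm) / u)| + |Real.log (pm / u)| + |Real.log (pp / u)|) ≤
        (k * |Real.log ((1 - pp) * (1 - pm) / u)| + |Real.log (pm / u)| + |Real.log (pp / u)|) *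
          ((n : ℝ) ^ γ * Real.log n) := by
      have hpos : 0 ≤ k * |Real.log ((1 - pp) * (1 - pm) / u)| + |Real.log (pm / u)| + |Real.log (pp / u)| := by
        positivity
      have a1 := mul_le_mul_of_nonneg_left hX2 hpos
      linarith only [a1]
    have s5 : 32 * (k : ℝ) / c + 20 * k / u ≤ (32 * k / c + 20 * k / u) * ((n : ℝ) ^ γ * Real.log n) :=
      le_mul_of_one_le_right (by positivity) hX3
    have s6 : (0 : ℝ) ≤ 1 * ((n : ℝ) ^ γ * Real.log n) := by positivity
    rw [hK]
    linarith only [hτ, hG, s1, s2, s3, s4, s5, s6]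
  -- conclude
  have hquot : ε / ((n : ℝ) + 1) ^ 2 = Real.exp (Real.log ε - 2 * Real.log ((n : ℝ) + 1)) := by
    rw [Real.exp_sub, Real.exp_log hε, show 2 * Real.log ((n : ℝ) + 1) = Real.log (((n : ℝ) + 1) ^ 2) by
      rw [Real.log_pow]; norm_num, Real.exp_log (by positivity)]
  constructor
  · refine hup.trans (le_trans ?_ (mul_le_mul_of_nonneg_left hlow (by positivity)))
    rw [hquot, ← Real.exp_add]
    exact Real.exp_le_exp.2 (by linarith only [hmain, hslack])
  · have hupM := mwwF_le_exp (k := k) (a := a) (b := b) hlam0 hn1 hab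
    have hlowM := exp_le_mwwF (k := k) hlam0 hn1 hAsum
    refine hupM.trans (le_trans ?_ (mul_le_mul_of_nonneg_left hlowM (by positivity)))
    rw [hquot, ← Real.exp_add]
    apply Real.exp_le_exp.2
    have hX1 : Real.log n ≤ (n : ℝ) ^ γ * Real.log n := le_mul_of_one_le_left (by linarith) hγ1
    have hX2 : (n : ℝ) ^ γ ≤ (n : ℝ) ^ γ * Real.log n := le_mul_of_one_le_right (by positivity) hlog1
    have hX3 : 1 ≤ (n : ℝ) ^ γ * Real.log n := hγ1.trans hX2
    have s1 : ((k : ℝ) + 3) * (Real.log n / 2 + 1) + ((k : ℝ) + 3) * (Real.log n / 2 + 1) ≤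
        K * ((n : ℝ) ^ γ * Real.log n) := by
      have hK3 : 3 * ((k : ℝ) + 3) ≤ K := by
        rw [hK]
        have : (0:ℝ) ≤ 2 * |Real.log lam| + 2 * k + k * |Real.log ((1 - pp) * (1 - pm) / u)| +
          |Real.log (pm / u)| + |Real.log (pp / u)| + 32 * k / c + 20 * k / u + 1 := by positivity
        linarith only [this]
      have hprod : (0:ℝ) ≤ (n : ℝ) ^ γ * Real.log n := by positivity
      have a1 := mul_le_mul_of_nonneg_left hX1 (by positivity : (0:ℝ) ≤ (k:ℝ) + 3)
      have a2 := mul_le_mul_of_nonneg_left hX3 (by positivity : (0:ℝ) ≤ (k:ℝ) + 3)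
      have a3 := mul_le_mul_of_nonneg_right hK3 hprod
      linarith only [a1, a2, a3]
    linarith only [hmain, s1]

/-- **Window bookkeeping, eventually in `n`** (for a fixed `ℓ ≥ 1`, with `ρ_n = n^{-1/(2ℓ)}`,
`γ = 1/(5ℓ)`): the window radius is below the geometric threshold, the anchor is inside the window
(`1/n ≤ ρ_n`), `8 n^γ ≤ c n`, and the on-window error `32k n^{2γ}/(cn) + 20k n^γ ρ_n/u* ≤ t`.
[cite: Sly2010, proof of Lemma 3.3 ("Setting `θ* = ψ* = 1/(5ℓ)` …")] -/
theorem sly_window_eventually {pp pm : ℝ} (hpm : 0 < pm) (hlt : pm < pp) (hsum : pp + pm < 1)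
    {ℓ : ℕ} (hℓ : 1 ≤ ℓ) {t : ℝ} (ht : 0 < t) (k : ℕ) :
    ∃ n₁ : ℕ, ∀ n : ℕ, n₁ ≤ n →
      (n : ℝ) ^ (-(1 / (2 * (ℓ : ℝ)))) ≤ min (min (pp / 2) ((1 - pp - pm) / 4)) ((pp - pm) / 4) ∧
      (1 : ℝ) / n ≤ (n : ℝ) ^ (-(1 / (2 * (ℓ : ℝ)))) ∧
      8 * (n : ℝ) ^ (1 / (5 * (ℓ : ℝ))) ≤ min (pp / 2) ((1 - pp - pm) / 2) * n ∧
      32 * k * ((n : ℝ) ^ (1 / (5 * (ℓ : ℝ)))) ^ 2 / (min (pp / 2) ((1 - pp - pm) / 2) * n) +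
          20 * k * (n : ℝ) ^ (1 / (5 * (ℓ : ℝ))) * ((n : ℝ) ^ (-(1 / (2 * (ℓ : ℝ)))) / (1 - pp - pm)) ≤ t ∧
      1 ≤ n := by
  have hpp : 0 < pp := hpm.trans hlt
  have hu0 : 0 < 1 - pp - pm := by linarith
  have hℓR : (1 : ℝ) ≤ ℓ := by exact_mod_cast hℓ
  set γ : ℝ := 1 / (5 * (ℓ : ℝ)) with hγ
  set σ : ℝ := 1 / (2 * (ℓ : ℝ)) with hσ
  have hγ0 : 0 < γ := by positivity
  have hσ0 : 0 < σ := by positivity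
  have hγ5 : γ ≤ 1 / 5 := by
    rw [hγ]; apply div_le_div_of_nonneg_left zero_le_one (by norm_num); linarith
  have hγσ : γ < σ := by
    rw [hγ, hσ]; apply div_lt_div_of_pos_left one_pos (by positivity); linarith
  have hσ1 : σ ≤ 1 := by
    rw [hσ, div_le_one (by positivity)]; linarith
  set c : ℝ := min (pp / 2) ((1 - pp - pm) / 2) with hc
  have hc0 : 0 < c := lt_min (by linarith) (by linarith)
  have hρ₀ : 0 < min (min (pp / 2) ((1 - pp - pm) / 4)) ((pp - pm) / 4) :=
    lt_min (lt_min (by linarith) (by linarith)) (by linarith)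
  -- (i) the radius tends to `0`
  have ev1 : ∀ᶠ n : ℕ in atTop, (n : ℝ) ^ (-σ) ≤ min (min (pp / 2) ((1 - pp - pm) / 4)) ((pp - pm) / 4) :=
    ((tendsto_rpow_neg_atTop hσ0).comp tendsto_natCast_atTop_atTop).eventually (eventually_le_nhds hρ₀)
  -- (iii) `8 n^γ ≤ c n`
  have ev3 : ∀ᶠ n : ℕ in atTop, 8 * (n : ℝ) ^ γ ≤ c * n := by
    have h : Tendsto (fun n : ℕ => (n : ℝ) ^ (γ - 1)) atTop (𝓝 0) := by
      have := (tendsto_rpow_neg_atTop (by linarith : (0 : ℝ) < 1 - γ)).comp tendsto_natCast_atTop_atTop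
      refine this.congr fun n => ?_
      simp only [Function.comp, neg_sub]
    have h2 := h.eventually (eventually_le_nhds (by positivity : (0 : ℝ) < c / 8))
    filter_upwards [h2, eventually_ge_atTop 1] with n hn hn1
    have hn0 : (0 : ℝ) < n := by exact_mod_cast hn1
    have e : (n : ℝ) ^ γ = (n : ℝ) ^ (γ - 1) * n := by
      rw [Real.rpow_sub_one hn0.ne']; field_simp
    rw [e]; nlinarith
  -- (iv) the on-window error tends to `0`
  have ev4 : ∀ᶠ n : ℕ in atTop, 32 * k * ((n : ℝ) ^ γ) ^ 2 / (c * n) +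
      20 * k * (n : ℝ) ^ γ * ((n : ℝ) ^ (-σ) / (1 - pp - pm)) ≤ t := by
    have hA : Tendsto (fun n : ℕ => (n : ℝ) ^ (2 * γ - 1)) atTop (𝓝 0) := by
      have := (tendsto_rpow_neg_atTop (by linarith : (0 : ℝ) < 1 - 2 * γ)).comp tendsto_natCast_atTop_atTop
      refine this.congr fun n => ?_
      simp only [Function.comp, neg_sub]
    have hB : Tendsto (fun n : ℕ => (n : ℝ) ^ (γ - σ)) atTop (𝓝 0) := by
      have := (tendsto_rpow_neg_atTop (by linarith : (0 : ℝ) < σ - γ)).comp tendsto_natCast_atTop_atTop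
      refine this.congr fun n => ?_
      simp only [Function.comp, neg_sub]
    have hsum' := (hA.const_mul (32 * k / c)).add (hB.const_mul (20 * k / (1 - pp - pm)))
    rw [mul_zero, mul_zero, add_zero] at hsum'
    filter_upwards [hsum'.eventually (eventually_le_nhds ht), eventually_ge_atTop 1] with n hn hn1
    have hn0 : (0 : ℝ) < n := by exact_mod_cast hn1
    have e1 : 32 * k * ((n : ℝ) ^ γ) ^ 2 / (c * n) = 32 * k / c * (n : ℝ) ^ (2 * γ - 1) := by
      rw [show ((n : ℝ) ^ γ) ^ 2 = (n : ℝ) ^ (2 * γ) by rw [← Real.rpow_natCast, ← Real.rpow_mul hn0.le]; ring_nf,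
        Real.rpow_sub_one hn0.ne']
      field_simp
    have e2 : 20 * k * (n : ℝ) ^ γ * ((n : ℝ) ^ (-σ) / (1 - pp - pm)) =
        20 * k / (1 - pp - pm) * (n : ℝ) ^ (γ - σ) := by
      rw [Real.rpow_sub hn0, Real.rpow_neg hn0.le]
      field_simp
    rw [e1, e2]; exact hn
  obtain ⟨n₁, hn₁⟩ := eventually_atTop.1 (ev1.and (ev3.and (ev4.and (eventually_ge_atTop 1))))
  refine ⟨n₁, fun n hn => ?_⟩
  obtain ⟨h1, h3, h4, hn1⟩ := hn₁ n hn
  have hnR : (1 : ℝ) ≤ n := by exact_mod_cast hn1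
  refine ⟨h1, ?_, h3, h4, hn1⟩
  -- (ii) `1/n = n^{-1} ≤ n^{-σ}`
  rw [show (1 : ℝ) / n = (n : ℝ) ^ (-(1 : ℝ)) by rw [Real.rpow_neg_one]; simp]
  exact Real.rpow_le_rpow_of_exponent_le hnR (by linarith)

/-- A double sum over the plus region of a constant: `Σ_{a ≤ n} Σ_{b ≤ a} C ≤ (n+1)² C` for `C ≥ 0`.
[folklore] -/
theorem sum_range_sum_range_const_le {C : ℝ} (hC : 0 ≤ C) (n : ℕ) :
    ∑ a ∈ range (n + 1), ∑ _b ∈ range (a + 1), C ≤ ((n : ℝ) + 1) ^ 2 * C := by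
  calc ∑ a ∈ range (n + 1), ∑ _b ∈ range (a + 1), C
      ≤ ∑ _a ∈ range (n + 1), ((n : ℝ) + 1) * C := by
        refine sum_le_sum fun a ha => ?_
        rw [sum_const, card_range, nsmul_eq_mul]
        rw [mem_range] at ha
        have : ((a : ℝ) + 1) ≤ (n : ℝ) + 1 := by exact_mod_cast ha
        push_cast
        nlinarith
    _ = ((n : ℝ) + 1) ^ 2 * C := by rw [sum_const, card_range, nsmul_eq_mul]; push_cast; ring

/-- **The plus phase, for one `n`** (the sum manipulation of Sly's proof of Lemma 3.3, deterministic in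
all parameters): given a window radius `ρ` below the geometric threshold and containing the anchor
(`1/n ≤ ρ`), `8m' ≤ cn`, the on-window error `≤ t`, and the termwise off-window bound with constant
`δ` (as delivered by `sly_offWindow_pointwise`), one has, with `G₀ = k m' log C₀ + η⁻ log(p⁻/u*) + η⁺ log(p⁺/u*)`:
`E Z⁺_{G̃}(η) ≤ (1+δ) e^t e^{G₀} E Z⁺_{MWW}`, `e^{G₀} E Z⁺_{MWW} ≤ (1+δ) e^t E Z⁺_{G̃}(η)`, the anchor term
is at most `E Z⁺_{G̃}(η)`, the diagonal `Σ_a E Z^{a,a}_{G̃}(η) ≤ δ ·(anchor term)`, and `E Z⁺_{MWW} > 0`.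
[cite: Sly2010, proof of Lemma 3.3 (eqs. (e:gtEZ2)–(e:gtEZ4))] -/
theorem sly_plus_window_sums {n m' k ep em : ℕ} {lam pp pm ρ t δ : ℝ} (hlam : 0 < lam)
    (hpm : 0 < pm) (hlt : pm < pp) (hsum : pp + pm < 1)
    (hEα : lam * (1 - pp - pm) ^ (k + 1) = pp * (1 - pp) ^ k)
    (hEβ : lam * (1 - pp - pm) ^ (k + 1) = pm * (1 - pm) ^ k)
    (hn : 1 ≤ n) (hep : ep ≤ m') (hem : em ≤ m')
    (hρ : ρ ≤ min (min (pp / 2) ((1 - pp - pm) / 4)) ((pp - pm) / 4)) (hinv : (1 : ℝ) / n ≤ ρ)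
    (hm : 8 * (m' : ℝ) ≤ min (pp / 2) ((1 - pp - pm) / 2) * n)
    (hτ : 32 * k * (m' : ℝ) ^ 2 / (min (pp / 2) ((1 - pp - pm) / 2) * n) +
      20 * k * m' * (ρ / (1 - pp - pm)) ≤ t) (hδ : 0 ≤ δ)
    (hoff : ∀ a b : ℕ, a + b ≤ n →
      ρ < max |(a : ℝ) / n - pp| |(b : ℝ) / n - pm| → ρ < max |(a : ℝ) / n - pm| |(b : ℝ) / n - pp| →
        slyF n m' k lam a b ep em ≤ δ / ((n : ℝ) + 1) ^ 2 * slyF n m' k lam ⌊pp * n⌋₊ ⌊pm * n⌋₊ ep em ∧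
        mwwF n k lam a b ≤ δ / ((n : ℝ) + 1) ^ 2 * mwwF n k lam ⌊pp * n⌋₊ ⌊pm * n⌋₊) :
    slyZplus n m' k lam ep em ≤ (1 + δ) * Real.exp t *
        (Real.exp (k * m' * Real.log ((1 - pp) * (1 - pm) / (1 - pp - pm)) +
          em * Real.log (pm / (1 - pp - pm)) + ep * Real.log (pp / (1 - pp - pm))) * mwwZplus n k lam) ∧
      Real.exp (k * m' * Real.log ((1 - pp) * (1 - pm) / (1 - pp - pm)) +
          em * Real.log (pm / (1 - pp - pm)) + ep * Real.log (pp / (1 - pp - pm))) * mwwZplus n k lam ≤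
        (1 + δ) * Real.exp t * slyZplus n m' k lam ep em ∧
      slyF n m' k lam ⌊pp * n⌋₊ ⌊pm * n⌋₊ ep em ≤ slyZplus n m' k lam ep em ∧
      ∑ a ∈ range (n + 1), slyF n m' k lam a a ep em ≤ δ * slyF n m' k lam ⌊pp * n⌋₊ ⌊pm * n⌋₊ ep em ∧
      0 < mwwZplus n k lam := by
  classical
  -- basic constants
  have hpp : 0 < pp := hpm.trans hlt
  have hu0 : 0 < 1 - pp - pm := by linarith
  have hn0 : (0 : ℝ) < n := by exact_mod_cast hn
  have hρu : ρ ≤ (1 - pp - pm) / 4 := hρ.trans ((min_le_left _ _).trans (min_le_right _ _))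
  have hρd : ρ ≤ (pp - pm) / 4 := hρ.trans (min_le_right _ _)
  set a₀ : ℕ := ⌊pp * n⌋₊ with ha₀
  set b₀ : ℕ := ⌊pm * n⌋₊ with hb₀
  set G : ℝ := k * m' * Real.log ((1 - pp) * (1 - pm) / (1 - pp - pm)) +
    em * Real.log (pm / (1 - pp - pm)) + ep * Real.log (pp / (1 - pp - pm)) with hG
  set F : ℕ → ℕ → ℝ := fun a b => slyF n m' k lam a b ep em with hF
  set F₀ : ℕ → ℕ → ℝ := fun a b => mwwF n k lam a b with hF₀
  set W : ℕ → ℕ → Prop := fun a b => |(a : ℝ) / n - pp| ≤ ρ ∧ |(b : ℝ) / n - pm| ≤ ρ with hW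
  have hF0 : ∀ a b, 0 ≤ F a b := fun a b => slyF_nonneg n m' k hlam.le a b ep em
  have hF₀0 : ∀ a b, 0 ≤ F₀ a b := fun a b => mwwF_nonneg n k hlam.le a b
  -- the anchor lies in the window and in the plus region
  have hWa : W a₀ b₀ := ⟨(abs_floor_div_sub_le hpp.le hn).trans hinv, (abs_floor_div_sub_le hpm.le hn).trans hinv⟩
  have ha₀n : a₀ < n + 1 := by
    have h1 : (a₀ : ℝ) ≤ pp * n := Nat.floor_le (by positivity)
    have h2 : (a₀ : ℝ) ≤ n := h1.trans (by nlinarith)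
    exact_mod_cast (show (a₀ : ℝ) < n + 1 by linarith)
  have hb₀a : b₀ < a₀ + 1 := Nat.lt_succ_of_le (Nat.floor_mono (by nlinarith))
  -- on the window: the two-sided termwise comparison
  have hwin : ∀ a b, W a b → F a b ≤ Real.exp t * (Real.exp G * F₀ a b) ∧ Real.exp G * F₀ a b ≤ Real.exp t * F a b ∧
      ρ < max |(a : ℝ) / n - pm| |(b : ℝ) / n - pp| ∧ b < a := by
    intro a b hab
    obtain ⟨hg1, hg2, hg3, hg4⟩ := slyWindow_geometry hlt hρ hab.1 hab.2
    have ha : pp / 2 * n ≤ a := by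
      have := mul_le_mul_of_nonneg_right hg1 hn0.le
      rwa [div_mul_cancel₀ _ hn0.ne'] at this
    have hu : (1 - pp - pm) / 2 * n ≤ (n : ℝ) - a - b := by
      have := mul_le_mul_of_nonneg_right hg2 hn0.le
      have e : (1 - (a : ℝ) / n - (b : ℝ) / n) * n = (n : ℝ) - a - b := by field_simp
      rwa [e] at this
    have hba : b < a := by
      have : (b : ℝ) / n < (a : ℝ) / n := hg3
      rw [div_lt_div_iff_of_pos_right hn0] at this
      exact_mod_cast this
    have hab' : a + b < n := by
      have : ((a : ℝ) + b) < n := by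
        have := mul_pos hu0 hn0; linarith
      exact_mod_cast this
    have hC := abs_log_slyF_div_mwwF_sub_le hlam hpm hlt hsum hEα hEβ hn hep hem hρu hab.1 hab.2 ha hu hm
    have hlow := exp_le_slyF_window (k := k) hlam hpm hlt hsum hEα hEβ hn hep hem hρu hab.1 hab.2 ha hu hm
    have hFpos : 0 < F a b := lt_of_lt_of_le (Real.exp_pos _) hlow
    have hF₀pos : 0 < F₀ a b := lt_of_lt_of_le (Real.exp_pos _) (exp_le_mwwF (k := k) hlam hn hab'.le)
    have hC' : |Real.log (F a b / F₀ a b) - G| ≤ t := hC.trans hτ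
    rw [Real.log_div hFpos.ne' hF₀pos.ne', abs_le] at hC'
    refine ⟨?_, ?_, hg4, hba⟩
    · have : Real.log (F a b) ≤ Real.log (Real.exp t * (Real.exp G * F₀ a b)) := by
        rw [Real.log_mul (Real.exp_pos t).ne' (by positivity), Real.log_mul (Real.exp_pos G).ne' hF₀pos.ne',
          Real.log_exp, Real.log_exp]
        linarith [hC'.2]
      exact (Real.log_le_log_iff hFpos (by positivity)).1 this
    · have : Real.log (Real.exp G * F₀ a b) ≤ Real.log (Real.exp t * F a b) := by
        rw [Real.log_mul (Real.exp_pos G).ne' hF₀pos.ne', Real.log_mul (Real.exp_pos t).ne' hFpos.ne',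
          Real.log_exp, Real.log_exp]
        linarith [hC'.1]
      exact (Real.log_le_log_iff (by positivity) (by positivity)).1 this
  -- off the window, in the plus region
  have hoffW : ∀ a b, b ≤ a → ¬W a b → F a b ≤ δ / ((n : ℝ) + 1) ^ 2 * F a₀ b₀ ∧
      F₀ a b ≤ δ / ((n : ℝ) + 1) ^ 2 * F₀ a₀ b₀ := by
    intro a b hba hnW
    rcases le_or_gt (a + b) n with hab | hab
    · have h1 : ρ < max |(a : ℝ) / n - pp| |(b : ℝ) / n - pm| := by
        by_contra h
        push Not at h
        exact hnW ⟨(le_max_left _ _).trans h, (le_max_right _ _).trans h⟩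
      have h2 : ρ < max |(a : ℝ) / n - pm| |(b : ℝ) / n - pp| := by
        by_contra h
        push Not at h
        -- `(b, a)` would be in the window, forcing `a < b`
        have hWba : W b a := ⟨(le_max_right _ _).trans h, (le_max_left _ _).trans h⟩
        have := (hwin b a hWba).2.2.2
        omega
      exact hoff a b hab h1 h2
    · refine ⟨?_, ?_⟩
      · rw [hF]; simp only []
        rw [slyF_eq_zero_of_lt n m' k lam hab]
        exact mul_nonneg (by positivity) (hF0 a₀ b₀)
      · rw [hF₀]; simp only []
        rw [mwwF_eq_zero_of_lt n k lam hab]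
        exact mul_nonneg (by positivity) (hF₀0 a₀ b₀)
  -- split the sums by the window
  have hsplit : ∀ (g : ℕ → ℕ → ℝ), (∑ a ∈ range (n + 1), ∑ b ∈ range (a + 1), g a b) =
      (∑ a ∈ range (n + 1), ∑ b ∈ range (a + 1), if W a b then g a b else 0) +
      (∑ a ∈ range (n + 1), ∑ b ∈ range (a + 1), if W a b then 0 else g a b) := by
    intro g
    rw [← sum_add_distrib]
    refine sum_congr rfl fun a _ => ?_
    rw [← sum_add_distrib]
    refine sum_congr rfl fun b _ => ?_
    split_ifs <;> simp
  set SW : ℝ := ∑ a ∈ range (n + 1), ∑ b ∈ range (a + 1), if W a b then F a b else 0 with hSW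
  set SO : ℝ := ∑ a ∈ range (n + 1), ∑ b ∈ range (a + 1), if W a b then 0 else F a b with hSO
  set SW₀ : ℝ := ∑ a ∈ range (n + 1), ∑ b ∈ range (a + 1), if W a b then F₀ a b else 0 with hSW₀
  set SO₀ : ℝ := ∑ a ∈ range (n + 1), ∑ b ∈ range (a + 1), if W a b then 0 else F₀ a b with hSO₀
  have hS : slyZplus n m' k lam ep em = SW + SO := by rw [slyZplus_def]; exact hsplit F
  have hS₀ : mwwZplus n k lam = SW₀ + SO₀ := by rw [mwwZplus_def]; exact hsplit F₀
  -- nonnegativity of the split terms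
  have hI1 : ∀ a b, 0 ≤ (if W a b then F a b else 0) := fun a b => by
    split_ifs
    · exact hF0 a b
    · exact le_rfl
  have hI2 : ∀ a b, 0 ≤ (if W a b then 0 else F a b) := fun a b => by
    split_ifs
    · exact le_rfl
    · exact hF0 a b
  have hI3 : ∀ a b, 0 ≤ (if W a b then F₀ a b else 0) := fun a b => by
    split_ifs
    · exact hF₀0 a b
    · exact le_rfl
  have hI4 : ∀ a b, 0 ≤ (if W a b then 0 else F₀ a b) := fun a b => by
    split_ifs
    · exact le_rfl
    · exact hF₀0 a b
  -- the off-window parts are small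
  have hSO : SO ≤ δ * F a₀ b₀ := by
    calc SO ≤ ∑ a ∈ range (n + 1), ∑ _b ∈ range (a + 1), δ / ((n : ℝ) + 1) ^ 2 * F a₀ b₀ := by
          refine sum_le_sum fun a ha => sum_le_sum fun b hb => ?_
          rw [mem_range] at hb
          split_ifs with h
          · exact mul_nonneg (by positivity) (hF0 a₀ b₀)
          · exact (hoffW a b (by omega) h).1
      _ ≤ ((n : ℝ) + 1) ^ 2 * (δ / ((n : ℝ) + 1) ^ 2 * F a₀ b₀) :=
          sum_range_sum_range_const_le (mul_nonneg (by positivity) (hF0 a₀ b₀)) n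
      _ = δ * F a₀ b₀ := by field_simp
  have hSO₀ : SO₀ ≤ δ * F₀ a₀ b₀ := by
    calc SO₀ ≤ ∑ a ∈ range (n + 1), ∑ _b ∈ range (a + 1), δ / ((n : ℝ) + 1) ^ 2 * F₀ a₀ b₀ := by
          refine sum_le_sum fun a ha => sum_le_sum fun b hb => ?_
          rw [mem_range] at hb
          split_ifs with h
          · exact mul_nonneg (by positivity) (hF₀0 a₀ b₀)
          · exact (hoffW a b (by omega) h).2
      _ ≤ ((n : ℝ) + 1) ^ 2 * (δ / ((n : ℝ) + 1) ^ 2 * F₀ a₀ b₀) :=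
          sum_range_sum_range_const_le (mul_nonneg (by positivity) (hF₀0 a₀ b₀)) n
      _ = δ * F₀ a₀ b₀ := by field_simp
  -- the anchor term is in the window parts
  have hFa : F a₀ b₀ ≤ SW := by
    have h1 : (if W a₀ b₀ then F a₀ b₀ else 0) ≤ ∑ b ∈ range (a₀ + 1), if W a₀ b then F a₀ b else 0 :=
      single_le_sum (f := fun b => if W a₀ b then F a₀ b else 0) (fun b _ => hI1 a₀ b) (mem_range.2 hb₀a)
    have h2 : (∑ b ∈ range (a₀ + 1), if W a₀ b then F a₀ b else 0) ≤ SW :=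
      single_le_sum (f := fun a => ∑ b ∈ range (a + 1), if W a b then F a b else 0)
        (fun a _ => sum_nonneg fun b _ => hI1 a b) (mem_range.2 ha₀n)
    rw [if_pos hWa] at h1
    exact h1.trans h2
  have hF₀a : F₀ a₀ b₀ ≤ SW₀ := by
    have h1 : (if W a₀ b₀ then F₀ a₀ b₀ else 0) ≤ ∑ b ∈ range (a₀ + 1), if W a₀ b then F₀ a₀ b else 0 :=
      single_le_sum (f := fun b => if W a₀ b then F₀ a₀ b else 0) (fun b _ => hI3 a₀ b) (mem_range.2 hb₀a)
    have h2 : (∑ b ∈ range (a₀ + 1), if W a₀ b then F₀ a₀ b else 0) ≤ SW₀ :=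
      single_le_sum (f := fun a => ∑ b ∈ range (a + 1), if W a b then F₀ a b else 0)
        (fun a _ => sum_nonneg fun b _ => hI3 a b) (mem_range.2 ha₀n)
    rw [if_pos hWa] at h1
    exact h1.trans h2
  -- the window parts compare termwise
  have hSWle : SW ≤ Real.exp t * (Real.exp G * SW₀) := by
    rw [hSW₀, mul_sum, mul_sum]
    refine sum_le_sum fun a _ => ?_
    rw [mul_sum, mul_sum]
    refine sum_le_sum fun b _ => ?_
    split_ifs with h
    · exact (hwin a b h).1
    · simp
  have hSW₀le : Real.exp G * SW₀ ≤ Real.exp t * SW := by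
    rw [hSW, hSW₀, mul_sum, mul_sum]
    refine sum_le_sum fun a _ => ?_
    rw [mul_sum, mul_sum]
    refine sum_le_sum fun b _ => ?_
    split_ifs with h
    · exact (hwin a b h).2.1
    · simp
  -- positivity
  have hFa0 : 0 < F₀ a₀ b₀ := by
    have := (hwin a₀ b₀ hWa)
    have hab' : a₀ + b₀ < n := by
      obtain ⟨hg1, hg2, -, -⟩ := slyWindow_geometry hlt hρ hWa.1 hWa.2
      have : ((a₀ : ℝ) + b₀) < n := by
        have := mul_pos hu0 hn0
        have e := mul_le_mul_of_nonneg_right hg2 hn0.le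
        have e' : (1 - (a₀ : ℝ) / n - (b₀ : ℝ) / n) * n = (n : ℝ) - a₀ - b₀ := by field_simp
        rw [e'] at e; linarith
      exact_mod_cast this
    exact lt_of_lt_of_le (Real.exp_pos _) (exp_le_mwwF (k := k) hlam hn hab'.le)
  have hSO0 : 0 ≤ SO := sum_nonneg fun a _ => sum_nonneg fun b _ => hI2 a b
  have hSO₀0 : 0 ≤ SO₀ := sum_nonneg fun a _ => sum_nonneg fun b _ => hI4 a b
  have hS₀pos : 0 < mwwZplus n k lam := by
    rw [hS₀]; linarith only [hF₀a, hFa0, hSO₀0]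
  refine ⟨?_, ?_, hFa.trans (by rw [hS]; linarith only [hSO0]), ?_, hS₀pos⟩
  · -- `S = SW + SO ≤ (1+δ) SW ≤ (1+δ) e^t e^G SW₀ ≤ (1+δ) e^t e^G S₀`
    rw [hS, hS₀]
    have f1 : SO ≤ δ * SW := hSO.trans (mul_le_mul_of_nonneg_left hFa hδ)
    have f2 : (1 + δ) * SW ≤ (1 + δ) * (Real.exp t * (Real.exp G * SW₀)) :=
      mul_le_mul_of_nonneg_left hSWle (by positivity)
    have f3 : Real.exp G * SW₀ ≤ Real.exp G * (SW₀ + SO₀) :=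
      mul_le_mul_of_nonneg_left (le_add_of_nonneg_right hSO₀0) (Real.exp_pos G).le
    have f4 := mul_le_mul_of_nonneg_left f3 (by positivity : (0:ℝ) ≤ (1 + δ) * Real.exp t)
    calc SW + SO ≤ (1 + δ) * SW := by linarith only [f1]
      _ ≤ (1 + δ) * (Real.exp t * (Real.exp G * SW₀)) := f2
      _ = (1 + δ) * Real.exp t * (Real.exp G * SW₀) := by ring
      _ ≤ (1 + δ) * Real.exp t * (Real.exp G * (SW₀ + SO₀)) := f4
  · -- `e^G S₀ = e^G (SW₀ + SO₀) ≤ e^G (1+δ) SW₀ ≤ (1+δ) e^t SW ≤ (1+δ) e^t S`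
    rw [hS, hS₀]
    have g1 : SO₀ ≤ δ * SW₀ := hSO₀.trans (mul_le_mul_of_nonneg_left hF₀a hδ)
    have g2 : Real.exp G * (SW₀ + SO₀) ≤ Real.exp G * ((1 + δ) * SW₀) :=
      mul_le_mul_of_nonneg_left (by linarith only [g1]) (Real.exp_pos G).le
    have g3 : (1 + δ) * (Real.exp G * SW₀) ≤ (1 + δ) * (Real.exp t * SW) :=
      mul_le_mul_of_nonneg_left hSW₀le (by positivity)
    have g4 : Real.exp t * SW ≤ Real.exp t * (SW + SO) :=
      mul_le_mul_of_nonneg_left (le_add_of_nonneg_right hSO0) (Real.exp_pos t).le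
    have g5 := mul_le_mul_of_nonneg_left g4 (by positivity : (0:ℝ) ≤ 1 + δ)
    calc Real.exp G * (SW₀ + SO₀) ≤ Real.exp G * ((1 + δ) * SW₀) := g2
      _ = (1 + δ) * (Real.exp G * SW₀) := by ring
      _ ≤ (1 + δ) * (Real.exp t * SW) := g3
      _ ≤ (1 + δ) * (Real.exp t * (SW + SO)) := g5
      _ = (1 + δ) * Real.exp t * (SW + SO) := by ring
  · -- the diagonal is off the window
    calc ∑ a ∈ range (n + 1), slyF n m' k lam a a ep em
        ≤ ∑ _a ∈ range (n + 1), δ / ((n : ℝ) + 1) ^ 2 * F a₀ b₀ := by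
          refine sum_le_sum fun a _ => ?_
          have hnW : ¬W a a := by
            rintro ⟨h1, h2⟩
            rw [abs_le] at h1 h2
            linarith
          exact (hoffW a a le_rfl hnW).1
      _ = ((n : ℝ) + 1) * (δ / ((n : ℝ) + 1) ^ 2 * F a₀ b₀) := by rw [sum_const, card_range, nsmul_eq_mul]; push_cast; ring
      _ ≤ δ * F a₀ b₀ := by
          rw [show ((n : ℝ) + 1) * (δ / ((n : ℝ) + 1) ^ 2 * F a₀ b₀) = δ * F a₀ b₀ * (1 / ((n : ℝ) + 1)) by
            field_simp]
          have : 1 / ((n : ℝ) + 1) ≤ 1 := by rw [div_le_one (by positivity)]; linarith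
          exact mul_le_of_le_one_right (mul_nonneg hδ (hF0 a₀ b₀)) this

/-- Two-sided multiplicative closeness with ratio `(1+ε'/8)²`, `0 ≤ ε' ≤ 1`, gives relative error
`ε'/2`. [folklore] -/
theorem rel_error_of_two_sided {S X ε' : ℝ} (hX : 0 ≤ X) (hε0 : 0 ≤ ε') (hε1 : ε' ≤ 1)
    (h1 : S ≤ (1 + ε' / 8) ^ 2 * X) (h2 : X ≤ (1 + ε' / 8) ^ 2 * S) :
    (1 - ε' / 2) * X ≤ S ∧ S ≤ (1 + ε' / 2) * X := by
  have hp2 : 0 ≤ ε' ^ 2 := sq_nonneg ε'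
  have hp3 : 0 ≤ ε' ^ 3 := pow_nonneg hε0 3
  have hp21 : ε' ^ 2 ≤ ε' := by nlinarith
  constructor
  · have hq : (1 - ε' / 2) * (1 + ε' / 8) ^ 2 ≤ 1 := by
      have e : (1 - ε' / 2) * (1 + ε' / 8) ^ 2 = 1 - ε' / 4 - 7 * ε' ^ 2 / 64 - ε' ^ 3 / 128 := by ring
      rw [e]; linarith
    have hqpos : 0 < (1 + ε' / 8) ^ 2 := by positivity
    have hS : 0 ≤ S := by
      by_contra h
      push Not at h
      have := mul_neg_of_pos_of_neg hqpos h
      linarith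
    calc (1 - ε' / 2) * X ≤ (1 - ε' / 2) * ((1 + ε' / 8) ^ 2 * S) :=
          mul_le_mul_of_nonneg_left h2 (by linarith)
      _ = ((1 - ε' / 2) * (1 + ε' / 8) ^ 2) * S := by ring
      _ ≤ 1 * S := mul_le_mul_of_nonneg_right hq hS
      _ = S := one_mul S
  · have hq : (1 + ε' / 8) ^ 2 ≤ 1 + ε' / 2 := by
      have e : (1 + ε' / 8) ^ 2 = 1 + ε' / 4 + ε' ^ 2 / 64 := by ring
      rw [e]; linarith
    exact h1.trans (mul_le_mul_of_nonneg_right hq hX)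

/-- **Sly's Lemma 3.3 (first-moment form), proved.** For `d ≥ 3`, `λ > λ_c(𝕋_d)` and the asymmetric
critical point `(p⁺, p⁻)` of `Φ₁` (`exists_slyCriticalDensities`; `u* = 1-p⁺-p⁻`, and
`p^{±}/u* = q^{±}/(1-q^{±})` by `slyCritical_portWeight`), there is `γ = γ(d, λ) > 0` such that for
every `ε > 0`, all large `n`, and all `m' ≤ n^γ` there is `A = A(n, m') > 0` with, for all boundary
occupations `η⁺, η⁻ ≤ m'`:
`|E Z⁺_{G̃}(η) - A (p⁺/u*)^{η⁺} (p⁻/u*)^{η⁻}| ≤ ε A (p⁺/u*)^{η⁺} (p⁻/u*)^{η⁻}` and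
`|E Z⁻_{G̃}(η) - A (p⁻/u*)^{η⁺} (p⁺/u*)^{η⁻}| ≤ ε A (p⁻/u*)^{η⁺} (p⁺/u*)^{η⁻}`
— the multiplicative, uniform-in-`η` form of Sly's (e:gtEZ4)
`E Z⁺_{G̃}(η) = (1+o(1)) [C*/((1-q⁺)^{m'}(1-q⁻)^{m'})] Q_U⁺(η) E Z⁺_{MWW}` (here
`A = C₀^{(d-1)m'} E Z⁺_{MWW}`, `Q_U⁺(η)/((1-q⁺)^{m'}(1-q⁻)^{m'}) = (q⁺/(1-q⁺))^{η⁺}(q⁻/(1-q⁻))^{η⁻}`),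
from which his (e:gtEZa) `sup_η |E Z^{±}_{G̃}(η)/E Z^{±}_{G̃} - Q_U^{±}(η)| = o(1)` and (e:gtEZb)
`E Z⁺_{G̃} = (1+o(1)) E Z⁻_{G̃}` follow by summing over `η`. Proof: the dominant windows
(`sly_offWindow_pointwise`, `sly_window_eventually`), the on-window comparison
(`abs_log_slyF_div_mwwF_sub_le`), the sum manipulation (`sly_plus_window_sums`), and the minus phase by
swapping the halves (`slyZminus_eq_slyZplus_sub`). [cite: Sly2010, Lemma 3.3 and its proof (eqs. (e:gtEZa), (e:gtEZb), (e:gtEZ2)–(e:gtEZ4))] -/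
theorem sly_lemma33 {d : ℕ} (hd : 3 ≤ d) {lam pp pm : ℝ} (hlam : hardCoreThreshold d < lam)
    (hpm : 0 < pm) (hlt : pm < pp) (hsum : pp + pm < 1)
    (hEα : lam * (1 - pp - pm) ^ d = pp * (1 - pp) ^ (d - 1))
    (hEβ : lam * (1 - pp - pm) ^ d = pm * (1 - pm) ^ (d - 1)) :
    ∃ γ : ℝ, 0 < γ ∧ ∀ ε : ℝ, 0 < ε → ∃ n₀ : ℕ, ∀ n : ℕ, n₀ ≤ n → ∀ m' : ℕ, (m' : ℝ) ≤ (n : ℝ) ^ γ →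
      ∃ A : ℝ, 0 < A ∧ ∀ ep em : ℕ, ep ≤ m' → em ≤ m' →
        |slyZplus n m' (d - 1) lam ep em - A * ((pp / (1 - pp - pm)) ^ ep * (pm / (1 - pp - pm)) ^ em)| ≤
            ε * (A * ((pp / (1 - pp - pm)) ^ ep * (pm / (1 - pp - pm)) ^ em)) ∧
        |slyZminus n m' (d - 1) lam ep em - A * ((pm / (1 - pp - pm)) ^ ep * (pp / (1 - pp - pm)) ^ em)| ≤
            ε * (A * ((pm / (1 - pp - pm)) ^ ep * (pp / (1 - pp - pm)) ^ em)) := by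
  obtain ⟨ℓ, hℓ, hoffpt⟩ := sly_offWindow_pointwise hd hlam hpm hlt hsum hEα hEβ
  obtain ⟨k, rfl⟩ : ∃ k, d = k + 1 := ⟨d - 1, by omega⟩
  simp only [Nat.add_sub_cancel] at hEα hEβ hoffpt ⊢
  have hlam0 : 0 < lam := (hardCoreThreshold_pos hd).trans hlam
  have hpp : 0 < pp := hpm.trans hlt
  have hu0 : 0 < 1 - pp - pm := by linarith
  have hc0 : 0 < min (pp / 2) ((1 - pp - pm) / 2) := lt_min (by linarith) (by linarith)
  have hwp : 0 < pp / (1 - pp - pm) := div_pos hpp hu0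
  have hwm : 0 < pm / (1 - pp - pm) := div_pos hpm hu0
  refine ⟨1 / (5 * (ℓ : ℝ)), by positivity, fun ε hε => ?_⟩
  set ε' : ℝ := min ε 1 with hε'
  have hε'0 : 0 < ε' := lt_min hε one_pos
  have hε'1 : ε' ≤ 1 := min_le_right _ _
  have hε'ε : ε' ≤ ε := min_le_left _ _
  have ht : 0 < Real.log (1 + ε' / 8) := Real.log_pos (by linarith)
  obtain ⟨n₀, hn₀⟩ := hoffpt (ε' / 8) (by positivity)
  obtain ⟨n₁, hn₁⟩ := sly_window_eventually hpm hlt hsum hℓ ht k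
  refine ⟨max n₀ n₁, fun n hn m' hm' => ?_⟩
  obtain ⟨hρ₀, hinv, h8, hτbar, hn1⟩ := hn₁ n (le_of_max_le_right hn)
  have hnn₀ : n₀ ≤ n := le_of_max_le_left hn
  have hn0 : (0 : ℝ) < n := by exact_mod_cast hn1
  have hm0 : (0 : ℝ) ≤ m' := Nat.cast_nonneg _
  -- the hypotheses of the one-`n` lemma
  have hm8 : 8 * (m' : ℝ) ≤ min (pp / 2) ((1 - pp - pm) / 2) * n := by linarith
  have hρ0 : 0 ≤ (n : ℝ) ^ (-(1 / (2 * (ℓ : ℝ)))) := Real.rpow_nonneg hn0.le _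
  have hτ : 32 * k * (m' : ℝ) ^ 2 / (min (pp / 2) ((1 - pp - pm) / 2) * n) +
      20 * k * m' * ((n : ℝ) ^ (-(1 / (2 * (ℓ : ℝ)))) / (1 - pp - pm)) ≤ Real.log (1 + ε' / 8) := by
    have t1 : 32 * k * (m' : ℝ) ^ 2 / (min (pp / 2) ((1 - pp - pm) / 2) * n) ≤
        32 * k * ((n : ℝ) ^ (1 / (5 * (ℓ : ℝ)))) ^ 2 / (min (pp / 2) ((1 - pp - pm) / 2) * n) := by
      apply div_le_div_of_nonneg_right _ (by positivity)
      exact mul_le_mul_of_nonneg_left (pow_le_pow_left₀ hm0 hm' 2) (by positivity)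
    have t2 : 20 * k * m' * ((n : ℝ) ^ (-(1 / (2 * (ℓ : ℝ)))) / (1 - pp - pm)) ≤
        20 * k * (n : ℝ) ^ (1 / (5 * (ℓ : ℝ))) * ((n : ℝ) ^ (-(1 / (2 * (ℓ : ℝ)))) / (1 - pp - pm)) :=
      mul_le_mul_of_nonneg_right (mul_le_mul_of_nonneg_left hm' (by positivity)) (by positivity)
    linarith only [t1, t2, hτbar]
  -- `A`
  obtain ⟨-, -, -, -, hS₀pos⟩ := sly_plus_window_sums (ep := 0) (em := 0) hlam0 hpm hlt hsum hEα hEβ hn1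
    (Nat.zero_le m') (Nat.zero_le m') hρ₀ hinv hm8 hτ (by positivity : (0:ℝ) ≤ ε' / 8)
    (hn₀ n hnn₀ m' hm' 0 0 (Nat.zero_le m') (Nat.zero_le m'))
  set A : ℝ := Real.exp (k * m' * Real.log ((1 - pp) * (1 - pm) / (1 - pp - pm))) * mwwZplus n k lam with hA
  have hA0 : 0 < A := mul_pos (Real.exp_pos _) hS₀pos
  refine ⟨A, hA0, fun ep em hep hem => ?_⟩
  -- the exponential prefactor is `A`-times the port weight
  have hEG : ∀ e1 e2 : ℕ, Real.exp (k * m' * Real.log ((1 - pp) * (1 - pm) / (1 - pp - pm)) +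
      e2 * Real.log (pm / (1 - pp - pm)) + e1 * Real.log (pp / (1 - pp - pm))) * mwwZplus n k lam =
      A * ((pp / (1 - pp - pm)) ^ e1 * (pm / (1 - pp - pm)) ^ e2) := by
    intro e1 e2
    rw [Real.exp_add, Real.exp_add, ← Real.log_pow, ← Real.log_pow, Real.exp_log (pow_pos hwm _),
      Real.exp_log (pow_pos hwp _), hA]
    ring
  have het : Real.exp (Real.log (1 + ε' / 8)) = 1 + ε' / 8 := Real.exp_log (by linarith)
  -- the plus phase for `(η⁺, η⁻)` and for the swapped boundary `(η⁻, η⁺)`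
  obtain ⟨c1, c2, c3, c4, -⟩ := sly_plus_window_sums hlam0 hpm hlt hsum hEα hEβ hn1 hep hem hρ₀ hinv hm8 hτ
    (by positivity : (0:ℝ) ≤ ε' / 8) (hn₀ n hnn₀ m' hm' ep em hep hem)
  obtain ⟨c1', c2', c3', c4', -⟩ := sly_plus_window_sums hlam0 hpm hlt hsum hEα hEβ hn1 hem hep hρ₀ hinv hm8 hτ
    (by positivity : (0:ℝ) ≤ ε' / 8) (hn₀ n hnn₀ m' hm' em ep hem hep)
  rw [het, hEG] at c1 c2 c1' c2'
  have hq : (1 + ε' / 8) * (1 + ε' / 8) = (1 + ε' / 8) ^ 2 := by ring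
  rw [hq] at c1 c2 c1' c2'
  have hX : 0 ≤ A * ((pp / (1 - pp - pm)) ^ ep * (pm / (1 - pp - pm)) ^ em) := by positivity
  have hX' : 0 ≤ A * ((pp / (1 - pp - pm)) ^ em * (pm / (1 - pp - pm)) ^ ep) := by positivity
  obtain ⟨p1, p2⟩ := rel_error_of_two_sided hX hε'0.le hε'1 c1 c2
  obtain ⟨p1', p2'⟩ := rel_error_of_two_sided hX' hε'0.le hε'1 c1' c2'
  constructor
  · have m1 : 0 ≤ (ε - ε' / 2) * (A * ((pp / (1 - pp - pm)) ^ ep * (pm / (1 - pp - pm)) ^ em)) :=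
      mul_nonneg (by linarith) hX
    rw [abs_le]
    constructor
    · linarith only [p1, m1]
    · linarith only [p2, m1]
  · -- the minus phase: swap the halves and drop the (negligible) diagonal
    rw [slyZminus_eq_slyZplus_sub lam hep hem,
      show (pm / (1 - pp - pm)) ^ ep * (pp / (1 - pp - pm)) ^ em =
        (pp / (1 - pp - pm)) ^ em * (pm / (1 - pp - pm)) ^ ep by ring]
    have hD0 : 0 ≤ ∑ a ∈ range (n + 1), slyF n m' k lam a a em ep :=
      sum_nonneg fun a _ => slyF_nonneg n m' k hlam0.le a a em ep
    have hD : ∑ a ∈ range (n + 1), slyF n m' k lam a a em ep ≤ ε' / 8 * slyZplus n m' k lam em ep :=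
      c4'.trans (mul_le_mul_of_nonneg_left c3' (by positivity))
    have m1 : 0 ≤ (ε - ε' / 2) * (A * ((pp / (1 - pp - pm)) ^ em * (pm / (1 - pp - pm)) ^ ep)) :=
      mul_nonneg (by linarith) hX'
    have m2 : 0 ≤ (ε - 5 * ε' / 8 + ε' ^ 2 / 16) * (A * ((pp / (1 - pp - pm)) ^ em * (pm / (1 - pp - pm)) ^ ep)) :=
      mul_nonneg (by nlinarith only [hε'ε, hε'0, hε'1]) hX'
    have m3 := mul_le_mul_of_nonneg_left p1' (by linarith : (0 : ℝ) ≤ 1 - ε' / 8)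
    rw [abs_le]
    constructor
    · linarith only [hD, m2, m3]
    · linarith only [p2', hD0, m1]

end Lemma33

/-! ### Sly's Lemma 3.3 as displayed: (e:gtEZa) and (e:gtEZb)

Summing `sly_lemma33` over the boundary occupations with binomial multiplicities gives
`E Z⁺_{G̃} = (1+o(1)) E Z⁻_{G̃}` and `E Z^{±}_{G̃}(η) = (1+o(1)) Q_U^{±}(η) E Z^{±}_{G̃}` uniformly in `η`,
with Sly's product measures `Q_U^{±}` built from `q⁺ = p⁺/(1-p⁻)`, `q⁻ = p⁻/(1-p⁺)`. -/

section Lemma33Phases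

open Finset

/-- Binomial resummation of the port weights: `Σ_{e ≤ m'} C(m', e) w^e = (1 + w)^{m'}`. [folklore] -/
theorem sum_choose_mul_pow_eq (m' : ℕ) (w : ℝ) :
    ∑ e ∈ range (m' + 1), (m'.choose e : ℝ) * w ^ e = (1 + w) ^ m' := by
  rw [show (1 : ℝ) + w = w + 1 by ring, add_pow]
  refine sum_congr rfl fun e he => ?_
  rw [one_pow, mul_one, mul_comm]

/-- The port law from the weights: for `e ≤ m'`, `w ≥ 0`,
`w^e/(1+w)^{m'} = (w/(1+w))^e (1/(1+w))^{m'-e}`. [folklore] -/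
theorem pow_div_pow_eq_portLaw {w : ℝ} (hw : 0 ≤ w) {m' e : ℕ} (he : e ≤ m') :
    w ^ e / (1 + w) ^ m' = (w / (1 + w)) ^ e * (1 / (1 + w)) ^ (m' - e) := by
  have h1 : (0 : ℝ) < 1 + w := by linarith
  obtain ⟨t, rfl⟩ := Nat.exists_eq_add_of_le he
  rw [Nat.add_sub_cancel_left, div_pow, div_pow, one_pow, pow_add, div_mul_div_comm, mul_one]

/-- **Sly's Lemma 3.3 as displayed: (e:gtEZa) and (e:gtEZb).** With `E Z^{±}_{G̃} = Σ_η E Z^{±}_{G̃}(η)`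
(the boundary configurations `η` on `U = U⁺ ∪ U⁻`, `|U^{±}| = m'`, grouped by their occupation numbers:
`Σ_{η⁺, η⁻ ≤ m'} C(m',η⁺) C(m',η⁻) E Z^{±}_{G̃}(η⁺,η⁻)`) and Sly's product measures
`Q_U⁺(η) = (q⁺)^{η⁺}(1-q⁺)^{m'-η⁺}(q⁻)^{η⁻}(1-q⁻)^{m'-η⁻}`, `Q_U⁻` with `q^{±}` interchanged, where
`q⁺ = p⁺/(1-p⁻)`, `q⁻ = p⁻/(1-p⁺)` (eq. (e:pqRelation)): for `d ≥ 3`, `λ > λ_c(𝕋_d)` and the critical point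
`(p⁺,p⁻)` there is `γ > 0` such that for every `ε > 0`, all large `n` and all `m' ≤ n^γ`,
`|E Z⁺_{G̃} - E Z⁻_{G̃}| ≤ ε E Z⁻_{G̃}` ("`E Z⁺_{G̃} = (1+o(1)) E Z⁻_{G̃}`", (e:gtEZb)) and, for all `η`,
`|E Z^{±}_{G̃}(η) - Q_U^{±}(η) E Z^{±}_{G̃}| ≤ ε Q_U^{±}(η) E Z^{±}_{G̃}` (the multiplicative form of
"`sup_η |E Z^{±}_{G̃}(η)/E Z^{±}_{G̃} - Q_U^{±}(η)| = o(1)`", (e:gtEZa)). From `sly_lemma33` by the binomial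
theorem (`Σ_η⁺ C(m',η⁺)(p⁺/u*)^{η⁺} = (1 + p⁺/u*)^{m'}`, and `(p⁺/u*)/(1+p⁺/u*) = p⁺/(1-p⁻) = q⁺`).
[cite: Sly2010, Lemma 3.3 (eqs. (e:gtEZa), (e:gtEZb))] -/
theorem sly_lemma33_phases {d : ℕ} (hd : 3 ≤ d) {lam pp pm : ℝ} (hlam : hardCoreThreshold d < lam)
    (hpm : 0 < pm) (hlt : pm < pp) (hsum : pp + pm < 1)
    (hEα : lam * (1 - pp - pm) ^ d = pp * (1 - pp) ^ (d - 1))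
    (hEβ : lam * (1 - pp - pm) ^ d = pm * (1 - pm) ^ (d - 1)) :
    ∃ γ : ℝ, 0 < γ ∧ ∀ ε : ℝ, 0 < ε → ∃ n₀ : ℕ, ∀ n : ℕ, n₀ ≤ n → ∀ m' : ℕ, (m' : ℝ) ≤ (n : ℝ) ^ γ →
      |(∑ ep ∈ range (m' + 1), ∑ em ∈ range (m' + 1),
          (m'.choose ep : ℝ) * (m'.choose em) * slyZplus n m' (d - 1) lam ep em) -
        (∑ ep ∈ range (m' + 1), ∑ em ∈ range (m' + 1),
          (m'.choose ep : ℝ) * (m'.choose em) * slyZminus n m' (d - 1) lam ep em)| ≤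
        ε * (∑ ep ∈ range (m' + 1), ∑ em ∈ range (m' + 1),
          (m'.choose ep : ℝ) * (m'.choose em) * slyZminus n m' (d - 1) lam ep em) ∧
      ∀ ep em : ℕ, ep ≤ m' → em ≤ m' →
        |slyZplus n m' (d - 1) lam ep em -
            ((pp / (1 - pm)) ^ ep * (1 - pp / (1 - pm)) ^ (m' - ep) *
              ((pm / (1 - pp)) ^ em * (1 - pm / (1 - pp)) ^ (m' - em))) *
            ∑ e1 ∈ range (m' + 1), ∑ e2 ∈ range (m' + 1),
              (m'.choose e1 : ℝ) * (m'.choose e2) * slyZplus n m' (d - 1) lam e1 e2| ≤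
          ε * (((pp / (1 - pm)) ^ ep * (1 - pp / (1 - pm)) ^ (m' - ep) *
              ((pm / (1 - pp)) ^ em * (1 - pm / (1 - pp)) ^ (m' - em))) *
            ∑ e1 ∈ range (m' + 1), ∑ e2 ∈ range (m' + 1),
              (m'.choose e1 : ℝ) * (m'.choose e2) * slyZplus n m' (d - 1) lam e1 e2) ∧
        |slyZminus n m' (d - 1) lam ep em -
            ((pm / (1 - pp)) ^ ep * (1 - pm / (1 - pp)) ^ (m' - ep) *
              ((pp / (1 - pm)) ^ em * (1 - pp / (1 - pm)) ^ (m' - em))) *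
            ∑ e1 ∈ range (m' + 1), ∑ e2 ∈ range (m' + 1),
              (m'.choose e1 : ℝ) * (m'.choose e2) * slyZminus n m' (d - 1) lam e1 e2| ≤
          ε * (((pm / (1 - pp)) ^ ep * (1 - pm / (1 - pp)) ^ (m' - ep) *
              ((pp / (1 - pm)) ^ em * (1 - pp / (1 - pm)) ^ (m' - em))) *
            ∑ e1 ∈ range (m' + 1), ∑ e2 ∈ range (m' + 1),
              (m'.choose e1 : ℝ) * (m'.choose e2) * slyZminus n m' (d - 1) lam e1 e2) := by
  obtain ⟨γ, hγ, h33⟩ := sly_lemma33 hd hlam hpm hlt hsum hEα hEβ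
  have hpp : 0 < pp := hpm.trans hlt
  have hu0 : 0 < 1 - pp - pm := by linarith
  refine ⟨γ, hγ, fun ε hε => ?_⟩
  set ε' : ℝ := min (ε / 4) (1 / 2) with hε'
  have hε'0 : 0 < ε' := lt_min (by positivity) (by norm_num)
  have hε'ε : ε' ≤ ε / 4 := min_le_left _ _
  have hε'h : ε' ≤ 1 / 2 := min_le_right _ _
  obtain ⟨n₀, hn₀⟩ := h33 ε' hε'0
  refine ⟨n₀, fun n hn m' hm' => ?_⟩
  obtain ⟨A, hA, hAe⟩ := hn₀ n hn m' hm'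
  set wp : ℝ := pp / (1 - pp - pm) with hwp
  set wm : ℝ := pm / (1 - pp - pm) with hwm
  have hwp0 : 0 < wp := div_pos hpp hu0
  have hwm0 : 0 < wm := div_pos hpm hu0
  set B : ℝ := (1 + wp) ^ m' * (1 + wm) ^ m' with hB
  have hB0 : 0 < B := by positivity
  set k := d - 1 with hk
  -- the two resummations
  have hsumP : ∑ ep ∈ range (m' + 1), ∑ em ∈ range (m' + 1),
      (m'.choose ep : ℝ) * (m'.choose em) * (A * (wp ^ ep * wm ^ em)) = A * B := by
    calc ∑ ep ∈ range (m' + 1), ∑ em ∈ range (m' + 1), (m'.choose ep : ℝ) * (m'.choose em) * (A * (wp ^ ep * wm ^ em))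
        = A * ∑ ep ∈ range (m' + 1), ∑ em ∈ range (m' + 1),
            ((m'.choose ep : ℝ) * wp ^ ep) * ((m'.choose em : ℝ) * wm ^ em) := by
          rw [mul_sum]; refine sum_congr rfl fun ep _ => ?_
          rw [mul_sum]; refine sum_congr rfl fun em _ => ?_
          ring
      _ = A * ((∑ ep ∈ range (m' + 1), (m'.choose ep : ℝ) * wp ^ ep) *
            (∑ em ∈ range (m' + 1), (m'.choose em : ℝ) * wm ^ em)) := by rw [sum_mul_sum]
      _ = A * B := by rw [sum_choose_mul_pow_eq, sum_choose_mul_pow_eq]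
  have hsumM : ∑ ep ∈ range (m' + 1), ∑ em ∈ range (m' + 1),
      (m'.choose ep : ℝ) * (m'.choose em) * (A * (wm ^ ep * wp ^ em)) = A * B := by
    calc ∑ ep ∈ range (m' + 1), ∑ em ∈ range (m' + 1), (m'.choose ep : ℝ) * (m'.choose em) * (A * (wm ^ ep * wp ^ em))
        = A * ∑ ep ∈ range (m' + 1), ∑ em ∈ range (m' + 1),
            ((m'.choose ep : ℝ) * wm ^ ep) * ((m'.choose em : ℝ) * wp ^ em) := by
          rw [mul_sum]; refine sum_congr rfl fun ep _ => ?_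
          rw [mul_sum]; refine sum_congr rfl fun em _ => ?_
          ring
      _ = A * ((∑ ep ∈ range (m' + 1), (m'.choose ep : ℝ) * wm ^ ep) *
            (∑ em ∈ range (m' + 1), (m'.choose em : ℝ) * wp ^ em)) := by rw [sum_mul_sum]
      _ = A * B := by rw [sum_choose_mul_pow_eq, sum_choose_mul_pow_eq, hB, mul_comm ((1 + wm) ^ m')]
  -- the totals are within `ε' A B` of `A B`
  set Zp : ℝ := ∑ ep ∈ range (m' + 1), ∑ em ∈ range (m' + 1),
    (m'.choose ep : ℝ) * (m'.choose em) * slyZplus n m' k lam ep em with hZp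
  set Zm : ℝ := ∑ ep ∈ range (m' + 1), ∑ em ∈ range (m' + 1),
    (m'.choose ep : ℝ) * (m'.choose em) * slyZminus n m' k lam ep em with hZm
  have hZpB : |Zp - A * B| ≤ ε' * (A * B) := by
    rw [hZp, ← hsumP, ← sum_sub_distrib]
    refine (abs_sum_le_sum_abs _ _).trans ?_
    rw [show ε' * (∑ ep ∈ range (m' + 1), ∑ em ∈ range (m' + 1),
        (m'.choose ep : ℝ) * (m'.choose em) * (A * (wp ^ ep * wm ^ em))) =
        ∑ ep ∈ range (m' + 1), ∑ em ∈ range (m' + 1),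
          (m'.choose ep : ℝ) * (m'.choose em) * (ε' * (A * (wp ^ ep * wm ^ em))) by
      rw [mul_sum]; refine sum_congr rfl fun ep _ => ?_; rw [mul_sum]; refine sum_congr rfl fun em _ => ?_; ring]
    refine sum_le_sum fun ep hep => ?_
    rw [← sum_sub_distrib]
    refine (abs_sum_le_sum_abs _ _).trans (sum_le_sum fun em hem => ?_)
    rw [mem_range] at hep hem
    rw [← mul_sub, abs_mul, abs_of_nonneg (by positivity)]
    exact mul_le_mul_of_nonneg_left (hAe ep em (by omega) (by omega)).1 (by positivity)
  have hZmB : |Zm - A * B| ≤ ε' * (A * B) := by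
    rw [hZm, ← hsumM, ← sum_sub_distrib]
    refine (abs_sum_le_sum_abs _ _).trans ?_
    rw [show ε' * (∑ ep ∈ range (m' + 1), ∑ em ∈ range (m' + 1),
        (m'.choose ep : ℝ) * (m'.choose em) * (A * (wm ^ ep * wp ^ em))) =
        ∑ ep ∈ range (m' + 1), ∑ em ∈ range (m' + 1),
          (m'.choose ep : ℝ) * (m'.choose em) * (ε' * (A * (wm ^ ep * wp ^ em))) by
      rw [mul_sum]; refine sum_congr rfl fun ep _ => ?_; rw [mul_sum]; refine sum_congr rfl fun em _ => ?_; ring]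
    refine sum_le_sum fun ep hep => ?_
    rw [← sum_sub_distrib]
    refine (abs_sum_le_sum_abs _ _).trans (sum_le_sum fun em hem => ?_)
    rw [mem_range] at hep hem
    rw [← mul_sub, abs_mul, abs_of_nonneg (by positivity)]
    exact mul_le_mul_of_nonneg_left (hAe ep em (by omega) (by omega)).2 (by positivity)
  rw [abs_le] at hZpB hZmB
  have hAB : 0 < A * B := mul_pos hA hB0
  -- the port laws are the normalised weights
  have h1m : (0 : ℝ) < 1 - pm := by linarith
  have h1p : (0 : ℝ) < 1 - pp := by linarith
  have ewp : 1 + wp = (1 - pm) / (1 - pp - pm) := by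
    rw [hwp, eq_div_iff hu0.ne', add_mul, div_mul_cancel₀ _ hu0.ne']; ring
  have ewm : 1 + wm = (1 - pp) / (1 - pp - pm) := by
    rw [hwm, eq_div_iff hu0.ne', add_mul, div_mul_cancel₀ _ hu0.ne']; ring
  have hq1 : pp / (1 - pm) = wp / (1 + wp) := by
    rw [ewp, hwp, div_div_div_cancel_right₀ hu0.ne']
  have hq2 : 1 - pp / (1 - pm) = 1 / (1 + wp) := by
    rw [ewp, one_div_div, one_sub_div h1m.ne', show (1 : ℝ) - pm - pp = 1 - pp - pm by ring]
  have hq3 : pm / (1 - pp) = wm / (1 + wm) := by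
    rw [ewm, hwm, div_div_div_cancel_right₀ hu0.ne']
  have hq4 : 1 - pm / (1 - pp) = 1 / (1 + wm) := by
    rw [ewm, one_div_div, one_sub_div h1p.ne']
  have hQ : ∀ ep em : ℕ, ep ≤ m' → em ≤ m' →
      (pp / (1 - pm)) ^ ep * (1 - pp / (1 - pm)) ^ (m' - ep) * ((pm / (1 - pp)) ^ em * (1 - pm / (1 - pp)) ^ (m' - em)) =
        wp ^ ep * wm ^ em / B ∧
      (pm / (1 - pp)) ^ ep * (1 - pm / (1 - pp)) ^ (m' - ep) * ((pp / (1 - pm)) ^ em * (1 - pp / (1 - pm)) ^ (m' - em)) =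
        wm ^ ep * wp ^ em / B := by
    intro ep em hep hem
    rw [hq2, hq4, hq1, hq3, ← pow_div_pow_eq_portLaw hwp0.le hep, ← pow_div_pow_eq_portLaw hwm0.le hem,
      ← pow_div_pow_eq_portLaw hwm0.le hep, ← pow_div_pow_eq_portLaw hwp0.le hem, hB]
    constructor
    · rw [div_mul_div_comm]
    · rw [div_mul_div_comm, mul_comm ((1 + wp) ^ m')]
  have hcoef : 2 * ε' ≤ ε - ε * ε' := by nlinarith only [hε'ε, hε'h, hε.le]
  -- a generic step: from the termwise bound and the total bound to the relative bound
  have key : ∀ (S W Z : ℝ), 0 < W → -(ε' * (A * W)) ≤ S - A * W → S - A * W ≤ ε' * (A * W) →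
      (1 - ε') * A ≤ Z / B → Z / B ≤ (1 + ε') * A →
      -(ε * (W / B * Z)) ≤ S - W / B * Z ∧ S - W / B * Z ≤ ε * (W / B * Z) := by
    intro S W Z hW h1 h2 h3 h4
    have e1 : W / B * Z = W * (Z / B) := by ring
    rw [e1]
    have l1 := mul_le_mul_of_nonneg_left h3 hW.le
    have l2 := mul_le_mul_of_nonneg_left h4 hW.le
    have l3 := mul_le_mul_of_nonneg_left l1 hε.le
    have c1 : (2 * ε') * (A * W) ≤ (ε - ε * ε') * (A * W) := mul_le_mul_of_nonneg_right hcoef (by positivity)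
    constructor
    · linarith only [h1, l2, l3, c1]
    · linarith only [h2, l1, l3, c1]
  have hZp1 : (1 - ε') * A ≤ Zp / B := by rw [le_div_iff₀ hB0]; linarith only [hZpB.1]
  have hZp2 : Zp / B ≤ (1 + ε') * A := by rw [div_le_iff₀ hB0]; linarith only [hZpB.2]
  have hZm1 : (1 - ε') * A ≤ Zm / B := by rw [le_div_iff₀ hB0]; linarith only [hZmB.1]
  have hZm2 : Zm / B ≤ (1 + ε') * A := by rw [div_le_iff₀ hB0]; linarith only [hZmB.2]
  refine ⟨?_, fun ep em hep hem => ?_⟩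
  · -- (e:gtEZb): `|Zp - Zm| ≤ 2ε' A B ≤ ε Zm`
    have t1 : ε' * (A * B) ≤ 1 / 2 * (A * B) := mul_le_mul_of_nonneg_right hε'h hAB.le
    have t2 : A * B ≤ 2 * Zm := by linarith only [hZmB.1, t1]
    have t3 : ε' * (A * B) ≤ ε / 4 * (A * B) := mul_le_mul_of_nonneg_right hε'ε hAB.le
    have t4 := mul_le_mul_of_nonneg_left t2 (by positivity : (0 : ℝ) ≤ ε / 2)
    rw [abs_le]
    constructor
    · linarith only [hZpB.1, hZmB.2, t3, t4]
    · linarith only [hZpB.2, hZmB.1, t3, t4]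
  · obtain ⟨Q1, Q2⟩ := hQ ep em hep hem
    obtain ⟨hP, hM⟩ := hAe ep em hep hem
    rw [abs_le] at hP hM
    constructor
    · rw [Q1, abs_le]
      exact key _ _ _ (by positivity) hP.1 hP.2 hZp1 hZp2
    · rw [Q2, abs_le]
      exact key _ _ _ (by positivity) hM.1 hM.2 hZm1 hZm2

end Lemma33Phases

end Literature.Computability.Complexity
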